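/-
Literature/AlgebraicGeometry/Pohlmann1968/DegenerateCMTypesAbelianCMFieldExponentTwicePrime.lean — pub-hodgecm2 (COR-CM), KEPT
Literature lane lit-deligne-3 gen 64, file F64a.  THEOREMS ONLY (no `def`, no named fact, no `sorry`, no instance, no notation;
D-0026 net debt 0).  HC_CM is NOT proved.
-/
import Literature.AlgebraicGeometry.Pohlmann1968.DegenerateCMTypesMultiquadraticCMField
import Literature.AlgebraicGeometry.Pohlmann1968.CMFieldDegreeLeSixAllPowersHodgeConjecture
import Literature.AlgebraicGeometry.Motives.AbelianVarietyBiproductIsogenies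
import Mathlib.NumberTheory.NumberField.Cyclotomic.Galois
import HarnessLib

/-!
# ABELIAN CM fields with Galois group of EXPONENT `2p` (`(ℤ/2)^r × (ℤ/p)^s`, `p` an odd prime): the rank of every CM type
# is `[K:ℚ]/2 + 1 − b(Φ) − (p − 1)·e(Φ)` — `b` Weil imaginary quadratic subfields, `e` CM subfields of degree `2p` over which
# the type is LEVEL; the nondegeneracy criterion and the Hodge conjecture for all powers off both lists; `ℚ(ζ₅₆), ℚ(ζ₇₂), ℚ(ζ₈₄)`

Topic `Literature/AlgebraicGeometry/Pohlmann1968` (namespace `Literature.AlgebraicGeometry.Pohlmann1968.ExponentTwicePrime`);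
cell `pub-hodgecm2` (COR-CM), KEPT Literature lane `lit-deligne-3` gen 64 (file F64a: the first half of the lane's «φ(N) = 24» band —
the levels `56, 72, 84`, `(ℤ/N)ˣ ≅ (ℤ/2)² × ℤ/6` — in its natural generality).  KERNEL ONLY: theorems; no `def`, no named fact, no
instance, no notation (D-0014 ∕ D-0026 net debt `0`).  HC_CM is NOT proved here or anywhere in the lane.

## Mathematics

T. Kubota [Kubota1965], §4 LEMMA 2: for a CM field `K` abelian over `ℚ` with group `G ∋ ρ` (complex conjugation), the DEFECT
`[K:ℚ]/2 + 1 − Rank(Φ)` of a CM type `Φ` (Rank = `dim MT(A_Φ)`) is the number of ODD characters `χ` of `G` (`χ(ρ) = −1`) with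
`χ(S) = Σ_{s ∈ S} χ(s) = 0`, `S = {g : σ_g ∈ Φ}`.  The tree groups these characters by KERNEL (S. P. White's proof of his Lemma 3:
characters with a common kernel `H` vanish together, each admissible kernel — `ρ ∉ H`, `G/H` cyclic — carrying `φ([G:H])` of them;
`NumberTheory/ComplexMultiplication/DegenerateCMTypesAbelianKernels`: `rank(S) + Σ_H φ([G:H]) = |G|/2 + 1`) and knows the vanishing
criterion at the kernels of index `2` (`#(S ∩ H) = #(S ∖ H)`: BALANCED — Weil type over the imaginary quadratic subfield `K^H`,
Dodson's constant weight criterion [Dodson1984] §3.1.1) and of index `2p^{a+1}` (`#(S ∩ gxH) = #(S ∩ gH)` for `x^p ∈ H`: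
EQUIDISTRIBUTED — Hazama's Lemma 4.6.1 mechanism [Hazama2003CyclicCM], Prop. 4.3).

THIS FILE: if `G = Gal(K/ℚ)` has EXPONENT dividing `2p` — `g^{2p} = 1` for all `g`; `G ≅ (ℤ/2)^r × (ℤ/p)^s` — then a cyclic
quotient `G/H` with `ρ ∉ H` has order `2` or `2p` (`index_eq_two_or_of_isCyclic_quotient`), and conversely EVERY subgroup of index
`2p` has cyclic quotient (`isCyclic_of_card_eq_two_mul`).  Hence Kubota's defect is EXACTLY

  `[K:ℚ]/2 + 1 − Rank(Φ) = b(Φ) + (p − 1)·e(Φ)`,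

`b(Φ) = #{F ⊆ K : [F:ℚ] = 2, F imaginary, Φ balanced over F}` and `e(Φ) = #{F ⊆ K : [F:ℚ] = 2p, F a CM field, Φ LEVEL of exponent
p over F}` — where LEVEL means: for every `σ ∈ Gal(F/ℚ)` with `σ^p = 1` and every `τ : F → ℂ`, `#{φ ∈ Φ : φ|_F = τ ∘ σ} =
#{φ ∈ Φ : φ|_F = τ}` (the multiplicities of `Φ|_F` are constant along the orbits of the `p`-torsion of `Gal(F/ℚ) ≅ ℤ/2p`, i.e.
`Φ|_F` is pulled back, with weights `(w, [K:F] − w)`, from the imaginary quadratic subfield of `F`; Yanai's "`n_i` = the number of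
elements of `S ∩ Hγ^i`" [Yanai2015IndexDegeneracy], proof of Thm. 4.1).  The exponent-`2` case (`p` absent, multiquadratic fields)
is the tree's `Multiquadratic.cmTypeRank_add_ncard_weilQuadratic_eq`; the case `G = ℤ/2 × ℤ/2p` refines to the lane's
`NonCyclicFourTimesPrime` theorem (there `e = 0` and `b ≤ 1` on PRIMITIVE types).

* §1 GROUP LEVEL (`G` commutative, `g^{2p} = 1`, `ρ`, `T ⊔ ρT = G`): `isCyclic_of_card_eq_two_mul`,
  **`index_eq_two_or_of_isCyclic_quotient`**, **`typeRank_add_card_add_mul_card_eq`** (`rank(T) + #B₂ + (p−1)·#B_{2p} = |G|/2 + 1`),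
  `typeRank_eq_iff` (nondegenerate iff `B₂ = B_{2p} = ∅`), `typeRank_add_card_modEq` (`rank + #B₂ ≡ |G|/2 + 1 (mod p − 1)`).
* §2 FIELD LEVEL (`K` CM, `IsAbelianGalois ℚ K`, `g^{2p} = 1` on `Gal(K/ℚ)`): `cmTypeRank_add_card_add_mul_card_eq` (on `Gal`),
  **`cmTypeRank_add_ncard_weilQuadratic_add_mul_card_eq`**, **`isNondegenerate_iff`**, `cmTypeRank_add_ncard_weilQuadratic_modEq`,
  `cmTypeRank_add_ncard_weilQuadratic_eq_iff`;
  §2b THE READING ON SUBFIELDS: **`forall_card_filter_eq_iff_level`** (equidistribution at `Gal(K/F)` ⟺ `Φ` level of exponent `p`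
  over `F`), **`card_index_eq_ncard_level`** (the equidistributed index-`2p` kernels ARE the CM subfields of degree `2p` over which `Φ`
  is level), **`cmTypeRank_add_ncard_weilQuadratic_add_mul_ncard_level_eq`** (THE INTRINSIC RANK FORMULA),
  **`isNondegenerate_iff_forall_intermediateField`** (NONDEGENERATE ⟺ Weil type over NO imaginary quadratic subfield ∧ level over NO
  CM subfield of degree `2p`).
* §3 ABELIAN VARIETIES: for every realisation `(A, ι, θ)` of a type off both lists, `B•(Aⁿ) ⊗ ℂ = D•(Aⁿ) ⊗ ℂ` and the Hodge conjecture
  for every power (`hodgeClassSpan_pow_eq_divisorClassesSpan_of_forall{_intermediateField}`,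
  **`hodgeConjectureFor_pow_of_forall{_intermediateField}`**, `not_exists_exceptional_pow_of_forall_intermediateField`) — UNCONDITIONAL
  (Hazama's criterion ∕ Pohlmann, tree `IsNondegenerate.hodgeClassSpan_pow_eq_divisorClassesSpan`); conversely a Weil quadratic subfield or a
  level CM subfield of degree `2p` makes the type degenerate (`not_isNondegenerate_of_balanced`, `…_of_equidistributed`).
* §4 CYCLOTOMIC FIELDS `ℚ(ζ_q)` with `u^{2p} = 1` on `(ℤ/q)ˣ` (`cm_abelian_pow_eq_one_of_isCyclotomicExtension`,
  `cmTypeRank_add_ncard_add_mul_ncard_eq_of_isCyclotomicExtension`, `isNondegenerate_iff_of_isCyclotomicExtension`,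
  `hodgeConjectureFor_pow_of_forall_of_isCyclotomicExtension`); the levels of `φ(N) = 24` with `(ℤ/N)ˣ ≅ (ℤ/2)² × ℤ/6`:
  `units_pow_six_fiftySix ∕ seventyTwo ∕ eightyFour` (kernel decision on residues), **`cmTypeRank_add_ncard_add_two_mul_ncard_fiftySix`**
  (`Rank(Φ) + b(Φ) + 2·e(Φ) = 13` for EVERY CM type of `ℚ(ζ₅₆)`), **`hodgeConjectureFor_pow_of_forall_fiftySix`**, and the same for `72`, `84`
  (in the level statements `σ³ = AlgEquiv.refl` spells `σ³ = 1`, keeping instance search off the cyclotomic tower).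
  APPENDED (gen 64, with the «φ(N) = 36» files): the level `63` (`(ℤ/63)ˣ ≅ ℤ/6 × ℤ/6`, degree `36`):
  `units_pow_six_sixtyThree`, **`cmTypeRank_add_ncard_add_two_mul_ncard_sixtyThree`** (`Rank + b + 2e = 19`), `hodgeConjectureFor_pow_of_forall_sixtyThree`.
  APPENDED (gen 64, «φ(N) = 40» instances): the levels `88, 132` (`(ℤ/q)ˣ ≅ (ℤ/2)² × ℤ/10`, `p = 5`, degree `40`):
  `units_pow_ten_eightyEight ∕ oneHundredThirtyTwo`, **`cmTypeRank_add_ncard_add_four_mul_ncard_eightyEight ∕ oneHundredThirtyTwo`** (`Rank + b + 4e = 21`),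
  `hodgeConjectureFor_pow_of_forall_eightyEight ∕ oneHundredThirtyTwo`.
  APPENDED (gen 64, «φ(N) = 44» instances): the levels `69, 92, 138` (`(ℤ/q)ˣ ≅ ℤ/2 × ℤ/22`, `p = 11`, degree `44`):
  `units_pow_twentyTwo_sixtyNine ∕ ninetyTwo ∕ oneHundredThirtyEight`, **`cmTypeRank_add_ncard_add_ten_mul_ncard_*`** (`Rank + b + 10e = 23`),
  `hodgeConjectureFor_pow_of_forall_*`.  Offline census for `G = (ℤ/2)² × ℤ/10 ∋ ρ` (kit job `j338436`, `2²⁰` types; NOT a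
  theorem): PRIMITIVE `1042680` — `(b, e) = (0,0)` rank `21` (NONDEGENERATE): `598120`; `(1,0)`: `221440`; `(2,0)`: `117120`; `(3,0)`: `79360`;
  `(0,1)`: `6720`; `(1,1)`: `10560`; `(2,1)`: `5760`; `(3,1)`: `2880`; `(0,2)` rank `13`: `720` — imprimitive `5896`.

NUMERICAL PICTURE (offline census of this seat, NOT a theorem of this file; `lane/census_e2p.py`): for `G = (ℤ/2)² × ℤ/6 ∋ ρ`
(levels `56, 72, 84`; `n = 12`, `4096` types) the pairs `(b, e)` and ranks are — imprimitive (`328` types): `(0,4)` rank `5`: `8`,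
`(2,2)` rank `7`: `144`, `(3,2)` rank `6`: `144`, `(3,3)` rank `4`: `24`, `(3,4)` rank `2`: `8`; PRIMITIVE (`3768` types): `(0,0)` rank
`13` (NONDEGENERATE): `1800`, `(1,0)` rank `12`: `672`, `(2,0)` rank `11`: `288`, `(0,1)` rank `11`: `192`, `(1,1)` rank `10`: `192`,
`(3,0)` rank `10`: `480`, `(0,2)` rank `9`: `144`.  So — unlike the `ℤ/2 × ℤ/2p` case — primitive types of `ℚ(ζ₅₆)` CAN be level over a
sextic CM subfield (`e ∈ {1, 2}`) and of Weil type over up to three imaginary quadratic subfields; §3 covers exactly the `1800` nondegenerate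
types (simple CM `12`-folds with `B = D` on all powers).  For `G = ℤ/2 × ℤ/6` the census `64 = 16 + 24 + 24` of the lane's
`NonCyclicFourTimesPrime.census_twentyOne` is recovered (`(b, e) ∈ {(0,0), (1,0)}` on primitive types).

PRESEARCH (lane rule): the displayed formula was not found in print as such (corpus hybrid + vector: Green–Griffiths–Kerr Ch. V,
Lang *Cyclotomic Fields*, Deligne–Milne–Ogus–Shih LNM 900; galaxy «degenerate CM-type | rank of a CM-type»: no statement) — it is
Kubota's Lemma 2 regrouped by kernels (White) with Dodson's index-`2` and Hazama's index-`2p` vanishing criteria, read through the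
Galois correspondence (Yanai); recorded as the lane's own elementary theorem with those citations.

HONEST REGISTER.  Everything here is unconditional and elementary given the tree's Kubota ∕ Hazama ∕ Pohlmann theorems.  Nothing is
claimed for the DEGENERATE types of these fields (`b + e > 0`): for them `Bᵐ ⊋ Dᵐ` in some degree (Lenstra, tree
`AbelianCMField.exists_exceptional_of_oddCharacter`) and the Hodge conjecture is OPEN in print beyond the Weil-type fourfold ∕ split
sixfold cases of Markman; HC_CM is NOT proved and not used.

## References

* [Kubota1965] T. Kubota, *On the field extension by complex multiplication*, Trans. AMS 118 (1965), §4 Lemma 2.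
* [White1993SporadicCycles] S. P. White, *Sporadic cycles on CM abelian varieties*, Compositio Math. 88 (1993), §4, proof of Lemma 3 (p. 131).
* [Dodson1984] B. Dodson, *The structure of Galois groups of CM-fields*, Trans. AMS 283 (1984), §3.1.1 Theorem, §3.2.1.
* [Hazama2003CyclicCM] F. Hazama, *Hodge cycles on abelian varieties with complex multiplication by cyclic CM-fields*, J. Math. Sci.
  Univ. Tokyo 10 (2003), Prop. 4.3, Lemma 4.6.1, Thm. 4.8.
* [Yanai2015IndexDegeneracy] H. Yanai, *On the index of degeneracy of a CM-type*, Thm. 4.1 (proof, p. 818).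
* [Gordon1999HodgeAVSurvey] B. B. Gordon, *A survey of the Hodge conjecture for abelian varieties*, 5.13 (ii), Thm. 6.4, §9.3, 9.4.1.
* [MilneFT2022] J. S. Milne, *Fields and Galois Theory*, Thm. 3.16–3.17 (Galois correspondence).
* [Shimura1998] G. Shimura, *Abelian Varieties with Complex Multiplication and Modular Functions*, §8.1, §18.2.
* [Washington1997] L. C. Washington, *Introduction to Cyclotomic Fields*, Ch. 2, Thm. 2.5.
* [Deligne2000] P. Deligne, *The Hodge conjecture* (Clay, 2000), §1.

## Provenance

Cell `pub-hodgecm2` (COR-CM), KEPT Literature lane `lit-deligne-3` gen 64 (claim ABELIAN-EXPONENT-2P-RANK-FORMULA; count-neutral, own lane),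
file F64a; neighbours cited by name, nothing restated: `DegenerateCMTypesAbelianKernels` (group level), `DegenerateCMTypesAbelianCMFieldKernels`,
`DegenerateCMTypesAbelianCMFieldCyclicSubfields` (the kernel ↔ subfield dictionary, `card_indexTwo_eq_ncard_weilQuadratic`,
`card_fibre_restrictNormalHom_eq`), `DegenerateCMTypesMultiquadraticCMField` (the exponent-`2` model), `NondegenerateCMTypeDivisorClasses`
(`IsNondegenerate.hodgeClassSpan_pow_eq_divisorClassesSpan`).  Theorems only; net Literature debt 0.
-/

noncomputable section

open scoped BigOperators NumberField IsMulCommutative Classical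
open NumberField IntermediateField

namespace Literature.AlgebraicGeometry.Pohlmann1968

namespace ExponentTwicePrime

open Literature.NumberTheory.ComplexMultiplication
open Literature.NumberTheory.ComplexMultiplication.CMNumbers
open Literature.AlgebraicGeometry.Motives (CMType)
open Literature.AlgebraicGeometry.Pohlmann1968.CyclicTwoOddPrimes (isCMTypeWith_galType cmTypeRank_eq_typeRank_galType)
open Literature.AlgebraicGeometry.Pohlmann1968.AbelianKernels

/-! ## §1 Group level: in exponent `2p` every admissible kernel has index `2` or `2p` -/

section Group

variable {G : Type*} [CommGroup G] {p : ℕ}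

/-- A commutative group of order `2p` (`p` an odd prime) is cyclic: an element of order `2` times an element of order `p`
generates. [folklore] -/
private theorem isCyclic_of_card_eq_two_mul [Finite G] [hp : Fact p.Prime] (hp2 : p ≠ 2) (hG : Nat.card G = 2 * p) : IsCyclic G := by
  haveI : Fact (Nat.Prime 2) := ⟨Nat.prime_two⟩
  obtain ⟨x, hx⟩ := exists_prime_orderOf_dvd_card' (G := G) 2 (by rw [hG]; exact dvd_mul_right 2 p)
  obtain ⟨y, hy⟩ := exists_prime_orderOf_dvd_card' (G := G) p (by rw [hG]; exact dvd_mul_left p 2)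
  have hcop : Nat.Coprime (orderOf x) (orderOf y) := by
    rw [hx, hy]; exact (Nat.coprime_primes Nat.prime_two hp.out).2 hp2.symm
  exact isCyclic_of_orderOf_eq_card (x * y)
    (by rw [(Commute.all x y).orderOf_mul_eq_mul_orderOf_of_coprime hcop, hx, hy, hG])

/-- **In a commutative group with `g^{2p} = 1` for all `g` (`p` an odd prime), a subgroup `H` missing an involution `ρ`
and with CYCLIC quotient `G/H` has index `2` or `2p`**: `|G/H|` divides the exponent `2p` and is even (`ρ̄` has order `2`).
Kubota's admissible kernels of `(ℤ/2)^r × (ℤ/p)^s` are its index-`2` and index-`2p` subgroups `H ∌ ρ`.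
[cite: Kubota1965, §4 Lemma 2] [cite: White1993SporadicCycles, §4, proof of Lemma 3 (p. 131)] -/
theorem index_eq_two_or_of_isCyclic_quotient [hp : Fact p.Prime] (hp2 : p ≠ 2) (hexp : ∀ g : G, g ^ (2 * p) = 1)
    {H : Subgroup G} {ρ : G} (hρH : ρ ∉ H) (hρ2 : ρ * ρ = 1) (hcyc : IsCyclic (G ⧸ H)) :
    H.index = 2 ∨ H.index = 2 * p := by
  haveI := hcyc
  have hdvd : H.index ∣ 2 * p := by
    rw [Subgroup.index_eq_card, ← IsCyclic.exponent_eq_card]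
    exact Monoid.exponent_dvd_of_forall_pow_eq_one fun q => QuotientGroup.induction_on q fun g => by
      rw [← QuotientGroup.mk_pow, hexp, QuotientGroup.mk_one]
  have hρ1 : (ρ : G ⧸ H) ≠ 1 := fun h => hρH ((QuotientGroup.eq_one_iff ρ).1 h)
  have hord : orderOf (ρ : G ⧸ H) = 2 := by
    haveI : Fact (Nat.Prime 2) := ⟨Nat.prime_two⟩
    refine orderOf_eq_prime ?_ hρ1
    rw [pow_two, ← QuotientGroup.mk_mul, hρ2, QuotientGroup.mk_one]
  have h2 : 2 ∣ H.index := by rw [Subgroup.index_eq_card, ← hord]; exact orderOf_dvd_natCard _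
  have hp2' : ¬ 2 ∣ p := fun h => hp2 ((Nat.prime_dvd_prime_iff_eq Nat.prime_two hp.out).1 h).symm
  obtain ⟨d₁, d₂, hd₁, hd₂, hdeq⟩ := Nat.dvd_mul.1 hdvd
  rcases (Nat.dvd_prime Nat.prime_two).1 hd₁ with rfl | rfl <;>
    rcases (Nat.dvd_prime hp.out).1 hd₂ with rfl | rfl
  · exfalso; rw [← hdeq] at h2; simp at h2
  · exfalso; rw [← hdeq, one_mul] at h2; exact hp2' h2
  · left; rw [← hdeq]
  · right; rw [← hdeq]

variable [Fintype G] [DecidableEq G]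

/-- **THE RANK OF A CM TYPE IN EXPONENT `2p` (group level).**  Let `G` be a finite commutative group with `g^{2p} = 1`
for all `g` (`p` an odd prime; `G ≅ (ℤ/2)^r × (ℤ/p)^s`), `ρ ∈ G` and `T` a CM type (`T ⊔ ρT = G`).  Then
`rank(T) + #B₂ + (p − 1)·#B_{2p} = |G|/2 + 1`, where `B₂` is the set of index-`2` subgroups `H ∌ ρ` splitting `T`
evenly (`#(T ∩ H) = #(T ∖ H)`) and `B_{2p}` the set of index-`2p` subgroups `H ∌ ρ` at which `T` is EQUIDISTRIBUTED
(`#(T ∩ gxH) = #(T ∩ gH)` for all `g` and all `x` with `x^p ∈ H`).  Kubota's defect `Σ_H φ([G:H])` over the admissible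
kernels (tree `AbelianKernels.typeRank_add_sum_totient_eq`): every admissible kernel has index `2` (`φ = 1`; its sign
character vanishes iff `H` splits `T` evenly, tree `…forall_sum_char_eq_zero_iff_of_index_two`) or `2p` (`φ = p − 1`; its
characters vanish iff `T` is equidistributed at `H`, Hazama's Lemma 4.6.1 mechanism, tree
`…forall_sum_char_eq_zero_iff_equidistributed_of_index`); a commutative group of order `2p` is cyclic, so EVERY index-`2p`
subgroup is admissible.  The exponent-`2` case (`p` absent) is the tree's `Multiquadratic.typeRank_add_card_indexTwo_eq`.
[cite: Kubota1965, §4 Lemma 2] [cite: Hazama2003CyclicCM, Prop. 4.3 and Lemma 4.6.1] [cite: Dodson1984, §3.1.1 Theorem] -/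
theorem typeRank_add_card_add_mul_card_eq [hp : Fact p.Prime] (hp2 : p ≠ 2) {ρ : G} {T : Finset G}
    (h : IsCMTypeWith ρ (T : Set G)) (hexp : ∀ g : G, g ^ (2 * p) = 1) :
    typeRank G (T : Set G) +
      ((Finset.univ : Finset (Subgroup G)).filter fun H => ρ ∉ H ∧ H.index = 2 ∧
        (T.filter fun s => s ∈ H).card = (T.filter fun s => s ∉ H).card).card +
      (p - 1) * ((Finset.univ : Finset (Subgroup G)).filter fun H => ρ ∉ H ∧ H.index = 2 * p ∧
        ∀ x : G, x ^ p ∈ H → ∀ g : G,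
          (T.filter fun s => (g * x)⁻¹ * s ∈ H).card = (T.filter fun s => g⁻¹ * s ∈ H).card).card =
      Fintype.card G / 2 + 1 := by
  have hρ2 : ρ * ρ = 1 := by simpa [smul_eq_mul] using h.invol (1 : G)
  have key := CyclicCMType.AbelianKernels.typeRank_add_sum_totient_eq h
  set A := (Finset.univ : Finset (Subgroup G)).filter (fun H => ρ ∉ H ∧ IsCyclic (G ⧸ H) ∧
    ∀ χ : AddChar (Additive G) ℂ, (∀ g : G, χ (Additive.ofMul g) = 1 ↔ g ∈ H) →
      ∑ s ∈ T, χ (Additive.ofMul s) = 0) with hA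
  set B₂ := (Finset.univ : Finset (Subgroup G)).filter (fun H => ρ ∉ H ∧ H.index = 2 ∧
    (T.filter fun s => s ∈ H).card = (T.filter fun s => s ∉ H).card) with hB₂
  set B' := (Finset.univ : Finset (Subgroup G)).filter (fun H => ρ ∉ H ∧ H.index = 2 * p ∧
    ∀ x : G, x ^ p ∈ H → ∀ g : G,
      (T.filter fun s => (g * x)⁻¹ * s ∈ H).card = (T.filter fun s => g⁻¹ * s ∈ H).card) with hB'
  -- the admissible kernels of index `2`
  have hA₂ : A.filter (fun H => H.index = 2) = B₂ := by
    rw [hA, hB₂, Finset.filter_filter]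
    refine Finset.filter_congr fun H _ => ?_
    constructor
    · rintro ⟨⟨hρH, -, hchar⟩, hidx⟩
      exact ⟨hρH, hidx,
        (CyclicCMType.AbelianKernels.forall_sum_char_eq_zero_iff_of_index_two hρ2 hρH hidx T).1 hchar⟩
    · rintro ⟨hρH, hidx, hsplit⟩
      haveI : Fact (Nat.Prime 2) := ⟨Nat.prime_two⟩
      exact ⟨⟨hρH, isCyclic_of_prime_card (p := 2) (by rw [← Subgroup.index_eq_card, hidx]),
        (CyclicCMType.AbelianKernels.forall_sum_char_eq_zero_iff_of_index_two hρ2 hρH hidx T).2 hsplit⟩, hidx⟩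
  -- the admissible kernels of index `2p`
  have hA' : A.filter (fun H => ¬ H.index = 2) = B' := by
    rw [hA, hB', Finset.filter_filter]
    refine Finset.filter_congr fun H _ => ?_
    constructor
    · rintro ⟨⟨hρH, hcyc, hchar⟩, hidx⟩
      have hidx' : H.index = 2 * p :=
        (index_eq_two_or_of_isCyclic_quotient hp2 hexp hρH hρ2 hcyc).resolve_left hidx
      have hidx'' : H.index = 2 * p ^ (0 + 1) := by rw [zero_add, pow_one]; exact hidx'
      exact ⟨hρH, hidx', (CyclicCMType.AbelianKernels.forall_sum_char_eq_zero_iff_equidistributed_of_index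
        hp2 h hρH hcyc hidx'').1 hchar⟩
    · rintro ⟨hρH, hidx, hE⟩
      have hcyc : IsCyclic (G ⧸ H) :=
        isCyclic_of_card_eq_two_mul hp2 (by rw [← Subgroup.index_eq_card, hidx])
      have hidx'' : H.index = 2 * p ^ (0 + 1) := by rw [zero_add, pow_one]; exact hidx
      have hp3 := hp.out.two_le
      refine ⟨⟨hρH, hcyc, (CyclicCMType.AbelianKernels.forall_sum_char_eq_zero_iff_equidistributed_of_index
        hp2 h hρH hcyc hidx'').2 hE⟩, ?_⟩
      rw [hidx]; omega
  have hsum : ∑ H ∈ A, H.index.totient = B₂.card + (p - 1) * B'.card := by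
    rw [← Finset.sum_filter_add_sum_filter_not A (fun H => H.index = 2), hA₂, hA']
    congr 1
    · rw [Finset.card_eq_sum_ones]
      exact Finset.sum_congr rfl fun H hH => by
        rw [hB₂, Finset.mem_filter] at hH
        rw [hH.2.2.1, Nat.totient_two]
    · rw [Finset.card_eq_sum_ones, Finset.mul_sum]
      exact Finset.sum_congr rfl fun H hH => by
        rw [hB', Finset.mem_filter] at hH
        rw [hH.2.2.1, Nat.totient_mul ((Nat.coprime_primes Nat.prime_two hp.out).2 hp2.symm), Nat.totient_two,
          Nat.totient_prime hp.out, one_mul, mul_one]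
  rw [add_assoc, ← hsum]
  exact key

/-- **NONDEGENERATE iff no index-`2` subgroup `H ∌ ρ` splits the type evenly and the type is equidistributed at no
index-`2p` subgroup `H ∌ ρ`** (exponent `2p`). [cite: Kubota1965, §4 Lemma 2] [cite: Hazama2003CyclicCM, Prop. 4.3]
[cite: Dodson1984, §3.1.1 Theorem] -/
theorem typeRank_eq_iff [hp : Fact p.Prime] (hp2 : p ≠ 2) {ρ : G} {T : Finset G}
    (h : IsCMTypeWith ρ (T : Set G)) (hexp : ∀ g : G, g ^ (2 * p) = 1) :
    typeRank G (T : Set G) = Fintype.card G / 2 + 1 ↔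
      (∀ H : Subgroup G, ρ ∉ H → H.index = 2 →
          (T.filter fun s => s ∈ H).card ≠ (T.filter fun s => s ∉ H).card) ∧
      (∀ H : Subgroup G, ρ ∉ H → H.index = 2 * p →
          ¬ ∀ x : G, x ^ p ∈ H → ∀ g : G,
            (T.filter fun s => (g * x)⁻¹ * s ∈ H).card = (T.filter fun s => g⁻¹ * s ∈ H).card) := by
  have key := typeRank_add_card_add_mul_card_eq hp2 h hexp
  set B₂ := (Finset.univ : Finset (Subgroup G)).filter (fun H => ρ ∉ H ∧ H.index = 2 ∧
    (T.filter fun s => s ∈ H).card = (T.filter fun s => s ∉ H).card) with hB₂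
  set B' := (Finset.univ : Finset (Subgroup G)).filter (fun H => ρ ∉ H ∧ H.index = 2 * p ∧
    ∀ x : G, x ^ p ∈ H → ∀ g : G,
      (T.filter fun s => (g * x)⁻¹ * s ∈ H).card = (T.filter fun s => g⁻¹ * s ∈ H).card) with hB'
  set c := (p - 1) * B'.card with hc
  have hp1 : p - 1 ≠ 0 := by have := hp.out.two_le; omega
  have step : typeRank G (T : Set G) = Fintype.card G / 2 + 1 ↔ B₂.card = 0 ∧ B'.card = 0 := by
    constructor
    · intro hr
      have h0 : B₂.card = 0 ∧ c = 0 := by omega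
      exact ⟨h0.1, (Nat.mul_eq_zero.1 h0.2).resolve_left hp1⟩
    · rintro ⟨h₁, h₂⟩
      have hc0 : c = 0 := by rw [hc, h₂, mul_zero]
      omega
  rw [step, Finset.card_eq_zero, Finset.card_eq_zero, hB₂, hB', Finset.filter_eq_empty_iff,
    Finset.filter_eq_empty_iff]
  simp only [Finset.mem_univ, forall_true_left, not_and, ne_eq]

/-- **Rank bound and congruence**: in exponent `2p`, `rank(T) ≥ |G|/2 + 1 − #B₂ − (p−1)·#B_{2p}` is an equality, so in
particular `rank(T) + #B₂ ≡ |G|/2 + 1 (mod p − 1)`. [cite: Kubota1965, §4 Lemma 2] -/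
theorem typeRank_add_card_modEq [hp : Fact p.Prime] (hp2 : p ≠ 2) {ρ : G} {T : Finset G}
    (h : IsCMTypeWith ρ (T : Set G)) (hexp : ∀ g : G, g ^ (2 * p) = 1) :
    typeRank G (T : Set G) +
      ((Finset.univ : Finset (Subgroup G)).filter fun H => ρ ∉ H ∧ H.index = 2 ∧
        (T.filter fun s => s ∈ H).card = (T.filter fun s => s ∉ H).card).card ≡
      Fintype.card G / 2 + 1 [MOD p - 1] := by
  have key := typeRank_add_card_add_mul_card_eq hp2 h hexp
  set B' := (Finset.univ : Finset (Subgroup G)).filter (fun H => ρ ∉ H ∧ H.index = 2 * p ∧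
    ∀ x : G, x ^ p ∈ H → ∀ g : G,
      (T.filter fun s => (g * x)⁻¹ * s ∈ H).card = (T.filter fun s => g⁻¹ * s ∈ H).card) with hB'
  rw [← key]
  exact (Nat.modEq_iff_dvd' (Nat.le_add_right _ _)).2 ⟨B'.card, by rw [Nat.add_sub_cancel_left]⟩

end Group

/-! ## §2 Abelian CM fields with Galois group of exponent `2p`: the defect is `b + (p − 1)·e` -/

section Field

variable {K : Type} [Field K] [NumberField K] [IsCMField K] [IsAbelianGalois ℚ K] {p : ℕ}

/-- **The defect on `Gal(K/ℚ)` for an abelian CM field of exponent `2p`** (`S = {g : σ_g ∈ Φ}`, `σ_g = φ₀ ∘ g⁻¹`,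
`ρ` = complex conjugation): `Rank(Φ) + #{H ≤ Gal(K/ℚ) : ρ ∉ H, [G:H] = 2, #(S ∩ H) = #(S ∖ H)} + (p − 1) · #{H : ρ ∉ H,
[G:H] = 2p, S equidistributed at H} = [K:ℚ]/2 + 1`. [cite: Kubota1965, §4 Lemma 2] [cite: Hazama2003CyclicCM, Prop. 4.3]
[cite: Dodson1984, §3.1.1 Theorem] -/
theorem cmTypeRank_add_card_add_mul_card_eq [Fact p.Prime] (hp2 : p ≠ 2) (φ₀ : K →+* ℂ)
    (hexp : ∀ g : K ≃ₐ[ℚ] K, g ^ (2 * p) = 1) (Φ : CMType K) :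
    cmTypeRank Φ +
      ((Finset.univ : Finset (Subgroup (K ≃ₐ[ℚ] K))).filter fun H =>
        (conjGal : K ≃ₐ[ℚ] K) ∉ H ∧ H.index = 2 ∧
        ((Finset.univ.filter fun g : K ≃ₐ[ℚ] K => embOf φ₀ g ∈ Φ.1).filter fun s => s ∈ H).card =
          ((Finset.univ.filter fun g : K ≃ₐ[ℚ] K => embOf φ₀ g ∈ Φ.1).filter fun s => s ∉ H).card).card +
      (p - 1) * ((Finset.univ : Finset (Subgroup (K ≃ₐ[ℚ] K))).filter fun H =>
        (conjGal : K ≃ₐ[ℚ] K) ∉ H ∧ H.index = 2 * p ∧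
        ∀ x : K ≃ₐ[ℚ] K, x ^ p ∈ H → ∀ g : K ≃ₐ[ℚ] K,
          ((Finset.univ.filter fun g : K ≃ₐ[ℚ] K => embOf φ₀ g ∈ Φ.1).filter fun s => (g * x)⁻¹ * s ∈ H).card =
          ((Finset.univ.filter fun g : K ≃ₐ[ℚ] K => embOf φ₀ g ∈ Φ.1).filter fun s => g⁻¹ * s ∈ H).card).card =
      Module.finrank ℚ K / 2 + 1 := by
  rw [cmTypeRank_eq_typeRank_galType Φ φ₀, ← card_gal_eq_finrank φ₀]
  exact typeRank_add_card_add_mul_card_eq hp2 (isCMTypeWith_galType (AbelianCMFieldExistence.apply_conjGal_eq φ₀) Φ)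
    hexp

/-- **THE RANK OF A CM TYPE OF AN ABELIAN CM FIELD OF EXPONENT `2p`.**  Let `K` be a CM field, abelian over `ℚ`, whose
Galois group satisfies `g^{2p} = 1` for all `g` (`Gal(K/ℚ) ≅ (ℤ/2)^r × (ℤ/p)^s`, `p` an odd prime — e.g. `ℚ(ζ₂₁), ℚ(ζ₂₈),
ℚ(ζ₃₆), ℚ(ζ₄₂)` (`ℤ/2 × ℤ/6`), `ℚ(ζ₅₆), ℚ(ζ₇₂), ℚ(ζ₈₄)` (`(ℤ/2)² × ℤ/6`), `ℚ(ζ₃₃), ℚ(ζ₄₄)` (`ℤ/2 × ℤ/10`), their CM subfields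
and composita with imaginary quadratic fields), and `Φ` ANY CM type of `K`.  Then
`Rank(Φ) + b(Φ) + (p − 1)·e(Φ) = [K:ℚ]/2 + 1`, where `b(Φ) = #{F ⊆ K : [F:ℚ] = 2, F imaginary, Φ balanced over F}` (over
every embedding `τ` of `F` as many extensions lie in `Φ` as outside it — Weil type over `F`) and `e(Φ)` is the number of
index-`2p` subgroups `H ∌ ρ` of `Gal(K/ℚ)` (the CM subfields `K^H` of degree `2p`, all cyclic) at which `S` is
equidistributed (`#(S ∩ gxH) = #(S ∩ gH)` for all `g` and all `x` with `x^p ∈ H`: the multiplicities of `Φ|_{K^H}` are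
constant along the orbits of the subgroup of order `p` of `Gal(K^H/ℚ)`).  The exponent-`2` case is the tree's
`Multiquadratic.cmTypeRank_add_ncard_weilQuadratic_eq`. [cite: Kubota1965, §4 Lemma 2] [cite: Hazama2003CyclicCM, Prop. 4.3 and Lemma 4.6.1]
[cite: Dodson1984, §3.1.1 Theorem] [cite: Gordon1999HodgeAVSurvey, 5.13 (ii) and 9.4.1] -/
theorem cmTypeRank_add_ncard_weilQuadratic_add_mul_card_eq [Fact p.Prime] (hp2 : p ≠ 2) (φ₀ : K →+* ℂ)
    (hexp : ∀ g : K ≃ₐ[ℚ] K, g ^ (2 * p) = 1) (Φ : CMType K) :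
    cmTypeRank Φ + {F : IntermediateField ℚ K | Module.finrank ℚ F = 2 ∧ ¬ IsTotallyReal F ∧
        ∀ τ : F →+* ℂ, {φ : K →+* ℂ | φ.comp (algebraMap F K) = τ ∧ φ ∈ Φ.1}.ncard =
          {φ : K →+* ℂ | φ.comp (algebraMap F K) = τ ∧ φ ∉ Φ.1}.ncard}.ncard +
      (p - 1) * ((Finset.univ : Finset (Subgroup (K ≃ₐ[ℚ] K))).filter fun H =>
        (conjGal : K ≃ₐ[ℚ] K) ∉ H ∧ H.index = 2 * p ∧
        ∀ x : K ≃ₐ[ℚ] K, x ^ p ∈ H → ∀ g : K ≃ₐ[ℚ] K,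
          ((Finset.univ.filter fun g : K ≃ₐ[ℚ] K => embOf φ₀ g ∈ Φ.1).filter fun s => (g * x)⁻¹ * s ∈ H).card =
          ((Finset.univ.filter fun g : K ≃ₐ[ℚ] K => embOf φ₀ g ∈ Φ.1).filter fun s => g⁻¹ * s ∈ H).card).card =
      Module.finrank ℚ K / 2 + 1 := by
  rw [← card_indexTwo_eq_ncard_weilQuadratic φ₀ Φ]
  exact cmTypeRank_add_card_add_mul_card_eq hp2 φ₀ hexp Φ

/-- **NONDEGENERACY CRITERION IN EXPONENT `2p`.**  A CM type `Φ` of an abelian CM field `K` with `Gal(K/ℚ)` of exponent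
dividing `2p` is NONDEGENERATE iff (i) `Φ` is balanced over NO imaginary quadratic subfield of `K` (is of Weil type over
none of them) and (ii) the type `S ⊆ Gal(K/ℚ)` is equidistributed at NO index-`2p` subgroup `H ∌ ρ` (no CM subfield of
degree `2p` sees `Φ` with multiplicities constant along its order-`p` orbits) — one surviving character per admissible
kernel (tree `AbelianKernels.isNondegenerate_iff_forall_exists_ker`), the admissible kernels having index `2` or `2p`.
[cite: Kubota1965, §4 Lemma 2] [cite: Hazama2003CyclicCM, Prop. 4.3] [cite: Dodson1984, §3.1.1 Theorem] -/
theorem isNondegenerate_iff [hp : Fact p.Prime] (hp2 : p ≠ 2) (φ₀ : K →+* ℂ)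
    (hexp : ∀ g : K ≃ₐ[ℚ] K, g ^ (2 * p) = 1) (Φ : CMType K) :
    IsNondegenerate Φ ↔
      (∀ F : IntermediateField ℚ K, Module.finrank ℚ F = 2 → ¬ IsTotallyReal F →
        ¬ ∀ τ : F →+* ℂ, {φ : K →+* ℂ | φ.comp (algebraMap F K) = τ ∧ φ ∈ Φ.1}.ncard =
          {φ : K →+* ℂ | φ.comp (algebraMap F K) = τ ∧ φ ∉ Φ.1}.ncard) ∧
      (∀ H : Subgroup (K ≃ₐ[ℚ] K), (conjGal : K ≃ₐ[ℚ] K) ∉ H → H.index = 2 * p →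
        ¬ ∀ x : K ≃ₐ[ℚ] K, x ^ p ∈ H → ∀ g : K ≃ₐ[ℚ] K,
          ((Finset.univ.filter fun g : K ≃ₐ[ℚ] K => embOf φ₀ g ∈ Φ.1).filter fun s => (g * x)⁻¹ * s ∈ H).card =
          ((Finset.univ.filter fun g : K ≃ₐ[ℚ] K => embOf φ₀ g ∈ Φ.1).filter fun s => g⁻¹ * s ∈ H).card) := by
  rw [Pohlmann1968.isNondegenerate_iff Φ, cmTypeRank_eq_typeRank_galType Φ φ₀, ← card_gal_eq_finrank φ₀,
    typeRank_eq_iff hp2 (isCMTypeWith_galType (AbelianCMFieldExistence.apply_conjGal_eq φ₀) Φ) hexp]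
  refine and_congr_left fun _ => ?_
  constructor
  · intro h F h2 hF hW
    have hρH : (conjGal : K ≃ₐ[ℚ] K) ∉ F.fixingSubgroup := (conjGal_not_mem_fixingSubgroup_iff F).2 hF
    exact h F.fixingSubgroup hρH (index_fixingSubgroup_eq_two F h2)
      ((card_filter_mem_eq_iff_balanced φ₀ Φ F h2 hF).2 hW)
  · intro h H hρH hidx hsplit
    have h2 : Module.finrank ℚ (fixedField H) = 2 := by rw [← index_eq_finrank_fixedField, hidx]
    have hF : ¬ IsTotallyReal (fixedField H) := (conjGal_not_mem_iff_not_isTotallyReal_fixedField H).1 hρH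
    refine h (fixedField H) h2 hF ((card_filter_mem_eq_iff_balanced φ₀ Φ (fixedField H) h2 hF).1 ?_)
    simpa only [fixingSubgroup_fixedField] using hsplit

/-- **The congruence `Rank(Φ) + b(Φ) ≡ [K:ℚ]/2 + 1 (mod p − 1)`** for every CM type of an abelian CM field of exponent `2p`:
the other admissible kernels contribute multiples of `φ(2p) = p − 1` to Kubota's defect. [cite: Kubota1965, §4 Lemma 2] -/
theorem cmTypeRank_add_ncard_weilQuadratic_modEq [Fact p.Prime] (hp2 : p ≠ 2)
    (hexp : ∀ g : K ≃ₐ[ℚ] K, g ^ (2 * p) = 1) (Φ : CMType K) :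
    cmTypeRank Φ + {F : IntermediateField ℚ K | Module.finrank ℚ F = 2 ∧ ¬ IsTotallyReal F ∧
        ∀ τ : F →+* ℂ, {φ : K →+* ℂ | φ.comp (algebraMap F K) = τ ∧ φ ∈ Φ.1}.ncard =
          {φ : K →+* ℂ | φ.comp (algebraMap F K) = τ ∧ φ ∉ Φ.1}.ncard}.ncard ≡
      Module.finrank ℚ K / 2 + 1 [MOD p - 1] := by
  obtain ⟨φ₀⟩ := (inferInstance : Nonempty (K →+* ℂ))
  have key := cmTypeRank_add_ncard_weilQuadratic_add_mul_card_eq hp2 φ₀ hexp Φ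
  rw [← key]
  exact (Nat.modEq_iff_dvd' (Nat.le_add_right _ _)).2 ⟨_, by rw [Nat.add_sub_cancel_left]⟩

/-- **Lower bound `Rank(Φ) + b(Φ) ≥ [K:ℚ]/2 + 1 − (p − 1)·e_max`** in the crude form `Rank(Φ) + b(Φ) ≤ [K:ℚ]/2 + 1` with
equality iff no index-`2p` kernel is equidistributed. [cite: Kubota1965, §4 Lemma 2] [cite: Dodson1984, §3.1.1 Theorem] -/
theorem cmTypeRank_add_ncard_weilQuadratic_eq_iff [hp : Fact p.Prime] (hp2 : p ≠ 2) (φ₀ : K →+* ℂ)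
    (hexp : ∀ g : K ≃ₐ[ℚ] K, g ^ (2 * p) = 1) (Φ : CMType K) :
    cmTypeRank Φ + {F : IntermediateField ℚ K | Module.finrank ℚ F = 2 ∧ ¬ IsTotallyReal F ∧
        ∀ τ : F →+* ℂ, {φ : K →+* ℂ | φ.comp (algebraMap F K) = τ ∧ φ ∈ Φ.1}.ncard =
          {φ : K →+* ℂ | φ.comp (algebraMap F K) = τ ∧ φ ∉ Φ.1}.ncard}.ncard = Module.finrank ℚ K / 2 + 1 ↔
      ∀ H : Subgroup (K ≃ₐ[ℚ] K), (conjGal : K ≃ₐ[ℚ] K) ∉ H → H.index = 2 * p →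
        ¬ ∀ x : K ≃ₐ[ℚ] K, x ^ p ∈ H → ∀ g : K ≃ₐ[ℚ] K,
          ((Finset.univ.filter fun g : K ≃ₐ[ℚ] K => embOf φ₀ g ∈ Φ.1).filter fun s => (g * x)⁻¹ * s ∈ H).card =
          ((Finset.univ.filter fun g : K ≃ₐ[ℚ] K => embOf φ₀ g ∈ Φ.1).filter fun s => g⁻¹ * s ∈ H).card := by
  have key := cmTypeRank_add_ncard_weilQuadratic_add_mul_card_eq hp2 φ₀ hexp Φ
  set B' := (Finset.univ : Finset (Subgroup (K ≃ₐ[ℚ] K))).filter (fun H =>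
    (conjGal : K ≃ₐ[ℚ] K) ∉ H ∧ H.index = 2 * p ∧
    ∀ x : K ≃ₐ[ℚ] K, x ^ p ∈ H → ∀ g : K ≃ₐ[ℚ] K,
      ((Finset.univ.filter fun g : K ≃ₐ[ℚ] K => embOf φ₀ g ∈ Φ.1).filter fun s => (g * x)⁻¹ * s ∈ H).card =
      ((Finset.univ.filter fun g : K ≃ₐ[ℚ] K => embOf φ₀ g ∈ Φ.1).filter fun s => g⁻¹ * s ∈ H).card) with hB'
  set c := (p - 1) * B'.card with hc
  have hp1 : p - 1 ≠ 0 := by have := hp.out.two_le; omega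
  have step : c = 0 ↔ B'.card = 0 := by
    rw [hc, Nat.mul_eq_zero]; exact ⟨fun h => h.resolve_left hp1, fun h => Or.inr h⟩
  rw [show (cmTypeRank Φ + _ = Module.finrank ℚ K / 2 + 1) ↔ c = 0 by constructor <;> intro h <;> omega, step,
    Finset.card_eq_zero, hB', Finset.filter_eq_empty_iff]
  simp only [Finset.mem_univ, forall_true_left, not_and]

end Field

/-! ## §2b The index-`2p` terms read on the lattice of subfields: CM subfields of degree `2p` over which `Φ` is LEVEL -/

section Reading

variable {K : Type} [Field K] [NumberField K] [IsCMField K] [IsAbelianGalois ℚ K] {p : ℕ}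

omit [IsCMField K] [IsAbelianGalois ℚ K] in
/-- `σ_{xg}|_F = σ_g|_F ∘ (x|_F)⁻¹` as embeddings of `F`: `embOf (φ₀|_F) (x̄ ḡ) = (embOf (φ₀|_F) ḡ) ∘ x̄⁻¹`. [cite: Shimura1998, §8.1] -/
private theorem embOf_mul_eq_comp (F : IntermediateField ℚ K) (ψ₀ : F →+* ℂ) (σ t : F ≃ₐ[ℚ] F) :
    embOf ψ₀ (σ * t) = (embOf ψ₀ t).comp (σ.symm : F ≃ₐ[ℚ] F).toRingEquiv.toRingHom := by
  refine RingHom.ext fun y => ?_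
  simp only [embOf_apply, RingHom.comp_apply]
  rfl

omit [IsCMField K] in
/-- **The coset counts at `H = Gal(K/F)` are multiplicities of `Φ|_F`**: `#(S ∩ gH) = #{φ ∈ Φ : φ|_F = σ_g|_F}` with
`σ_g|_F = embOf (φ₀|_F) (g|_F)`. [cite: Yanai2015IndexDegeneracy, Thm. 4.1 (proof, p. 818)] -/
private theorem card_filter_inv_mul_mem_eq (φ₀ : K →+* ℂ) (Φ : CMType K) (F : IntermediateField ℚ K) [Normal ℚ F]
    (g : K ≃ₐ[ℚ] K) :
    ((Finset.univ.filter fun s : K ≃ₐ[ℚ] K => embOf φ₀ s ∈ Φ.1).filter fun s => g⁻¹ * s ∈ F.fixingSubgroup).card =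
      {φ : K →+* ℂ | φ.comp (algebraMap F K) = embOf (φ₀.comp (algebraMap F K)) (AlgEquiv.restrictNormalHom F g) ∧
        φ ∈ Φ.1}.ncard := by
  have h1 : ((Finset.univ.filter fun s : K ≃ₐ[ℚ] K => embOf φ₀ s ∈ Φ.1).filter
      fun s => g⁻¹ * s ∈ F.fixingSubgroup) =
      ((Finset.univ.filter fun s : K ≃ₐ[ℚ] K => embOf φ₀ s ∈ Φ.1).filter
        fun s => AlgEquiv.restrictNormalHom F s = AlgEquiv.restrictNormalHom F g) :=
    Finset.filter_congr fun s _ => (restrictNormalHom_eq_iff F s g).symm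
  rw [h1, card_fibre_restrictNormalHom_eq φ₀ Φ F, ← Set.ncard_coe_finset]
  congr 1
  ext φ
  simp only [Finset.coe_filter, Finset.mem_univ, true_and, Set.mem_setOf_eq]
  tauto

omit [IsCMField K] in
/-- **EQUIDISTRIBUTION AT `Gal(K/F)` IS LEVELNESS OF `Φ` OVER `F`.**  For a subfield `F ⊆ K` the type `S ⊆ Gal(K/ℚ)` is
equidistributed at `H = Gal(K/F)` — `#(S ∩ gxH) = #(S ∩ gH)` for all `g` and all `x` with `x^p ∈ H` — iff `Φ` is LEVEL OF
EXPONENT `p` OVER `F`: for every `σ ∈ Gal(F/ℚ)` with `σ^p = 1` and every embedding `τ : F → ℂ`, as many `φ ∈ Φ` restrict to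
`τ ∘ σ` as to `τ` (the multiplicities of `Φ|_F` are constant along the orbits of the `p`-torsion of `Gal(F/ℚ)`; Yanai's
"`n_i` = the number of elements of `S ∩ Hγ^i`"). [cite: Yanai2015IndexDegeneracy, Thm. 4.1 (proof, p. 818)]
[cite: Hazama2003CyclicCM, Prop. 4.3 and Lemma 4.6.1] -/
theorem forall_card_filter_eq_iff_level (φ₀ : K →+* ℂ) (Φ : CMType K) (F : IntermediateField ℚ K) :
    (∀ x : K ≃ₐ[ℚ] K, x ^ p ∈ F.fixingSubgroup → ∀ g : K ≃ₐ[ℚ] K,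
        ((Finset.univ.filter fun s : K ≃ₐ[ℚ] K => embOf φ₀ s ∈ Φ.1).filter
            fun s => (g * x)⁻¹ * s ∈ F.fixingSubgroup).card =
          ((Finset.univ.filter fun s : K ≃ₐ[ℚ] K => embOf φ₀ s ∈ Φ.1).filter
            fun s => g⁻¹ * s ∈ F.fixingSubgroup).card) ↔
      ∀ σ : F ≃ₐ[ℚ] F, σ ^ p = 1 → ∀ τ : F →+* ℂ,
        {φ : K →+* ℂ | φ.comp (algebraMap F K) = τ.comp σ.toRingEquiv.toRingHom ∧ φ ∈ Φ.1}.ncard =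
          {φ : K →+* ℂ | φ.comp (algebraMap F K) = τ ∧ φ ∈ Φ.1}.ncard := by
  haveI := normal_of_isAbelianGalois F
  set ψ₀ : F →+* ℂ := φ₀.comp (algebraMap F K) with hψ₀
  have hres1 : ∀ x : K ≃ₐ[ℚ] K, x ^ p ∈ F.fixingSubgroup ↔ (AlgEquiv.restrictNormalHom F x) ^ p = 1 := fun x => by
    rw [← map_pow, restrictNormalHom_eq_one_iff]
  -- both coset counts as multiplicities
  have hcount : ∀ x g : K ≃ₐ[ℚ] K,
      ((Finset.univ.filter fun s : K ≃ₐ[ℚ] K => embOf φ₀ s ∈ Φ.1).filter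
          fun s => (g * x)⁻¹ * s ∈ F.fixingSubgroup).card =
        {φ : K →+* ℂ | φ.comp (algebraMap F K) =
          (embOf ψ₀ (AlgEquiv.restrictNormalHom F g)).comp
            ((AlgEquiv.restrictNormalHom F x).symm : F ≃ₐ[ℚ] F).toRingEquiv.toRingHom ∧ φ ∈ Φ.1}.ncard := by
    intro x g
    rw [mul_comm g x, card_filter_inv_mul_mem_eq φ₀ Φ F (x * g), map_mul, embOf_mul_eq_comp]
  constructor
  · intro h σ hσ τ
    obtain ⟨t, rfl⟩ := (embOf_bijective ψ₀).2 τ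
    obtain ⟨g, rfl⟩ := AlgEquiv.restrictNormalHom_surjective K t
    obtain ⟨x, hx⟩ := AlgEquiv.restrictNormalHom_surjective K (σ⁻¹ : F ≃ₐ[ℚ] F)
    have hxp : x ^ p ∈ F.fixingSubgroup := by rw [hres1, hx, inv_pow, hσ, inv_one]
    have key := h x hxp g
    rw [hcount, card_filter_inv_mul_mem_eq φ₀ Φ F g, hx] at key
    have hss : ((σ⁻¹ : F ≃ₐ[ℚ] F).symm : F ≃ₐ[ℚ] F) = σ := by
      rw [AlgEquiv.aut_inv, AlgEquiv.symm_symm]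
    rw [hss] at key
    exact key
  · intro h x hx g
    rw [hcount, card_filter_inv_mul_mem_eq φ₀ Φ F g]
    refine h _ ?_ _
    rw [← AlgEquiv.aut_inv, inv_pow, inv_eq_one, ← hres1]
    exact hx

/-- **The equidistributed index-`2p` kernels ARE the CM subfields of degree `2p` over which `Φ` is level**: `H ↦ K^H` is a
bijection from the index-`2p` subgroups `H ∌ ρ` of `Gal(K/ℚ)` at which `S` is equidistributed onto the subfields `F ⊆ K` with
`[F:ℚ] = 2p`, `F` not totally real (a CM subfield; cyclic over `ℚ`), over which `Φ` is level of exponent `p`.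
[cite: Yanai2015IndexDegeneracy, Thm. 4.1 (proof, p. 818)] [cite: MilneFT2022, Thm. 3.16] -/
theorem card_index_eq_ncard_level (φ₀ : K →+* ℂ) (Φ : CMType K) :
    ((Finset.univ : Finset (Subgroup (K ≃ₐ[ℚ] K))).filter fun H =>
        (conjGal : K ≃ₐ[ℚ] K) ∉ H ∧ H.index = 2 * p ∧
        ∀ x : K ≃ₐ[ℚ] K, x ^ p ∈ H → ∀ g : K ≃ₐ[ℚ] K,
          ((Finset.univ.filter fun g : K ≃ₐ[ℚ] K => embOf φ₀ g ∈ Φ.1).filter fun s => (g * x)⁻¹ * s ∈ H).card =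
          ((Finset.univ.filter fun g : K ≃ₐ[ℚ] K => embOf φ₀ g ∈ Φ.1).filter fun s => g⁻¹ * s ∈ H).card).card =
      {F : IntermediateField ℚ K | Module.finrank ℚ F = 2 * p ∧ ¬ IsTotallyReal F ∧
        ∀ σ : F ≃ₐ[ℚ] F, σ ^ p = 1 → ∀ τ : F →+* ℂ,
          {φ : K →+* ℂ | φ.comp (algebraMap F K) = τ.comp σ.toRingEquiv.toRingHom ∧ φ ∈ Φ.1}.ncard =
            {φ : K →+* ℂ | φ.comp (algebraMap F K) = τ ∧ φ ∈ Φ.1}.ncard}.ncard := by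
  set B := (Finset.univ : Finset (Subgroup (K ≃ₐ[ℚ] K))).filter (fun H =>
    (conjGal : K ≃ₐ[ℚ] K) ∉ H ∧ H.index = 2 * p ∧
    ∀ x : K ≃ₐ[ℚ] K, x ^ p ∈ H → ∀ g : K ≃ₐ[ℚ] K,
      ((Finset.univ.filter fun g : K ≃ₐ[ℚ] K => embOf φ₀ g ∈ Φ.1).filter fun s => (g * x)⁻¹ * s ∈ H).card =
      ((Finset.univ.filter fun g : K ≃ₐ[ℚ] K => embOf φ₀ g ∈ Φ.1).filter fun s => g⁻¹ * s ∈ H).card) with hB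
  have hinj : Function.Injective (fun H : Subgroup (K ≃ₐ[ℚ] K) => fixedField H) := fun H H' hHH' => by
    have := congrArg IntermediateField.fixingSubgroup hHH'
    simpa only [fixingSubgroup_fixedField] using this
  have himage : (fun H : Subgroup (K ≃ₐ[ℚ] K) => fixedField H) '' (↑B : Set (Subgroup (K ≃ₐ[ℚ] K))) =
      {F : IntermediateField ℚ K | Module.finrank ℚ F = 2 * p ∧ ¬ IsTotallyReal F ∧
        ∀ σ : F ≃ₐ[ℚ] F, σ ^ p = 1 → ∀ τ : F →+* ℂ,
          {φ : K →+* ℂ | φ.comp (algebraMap F K) = τ.comp σ.toRingEquiv.toRingHom ∧ φ ∈ Φ.1}.ncard =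
            {φ : K →+* ℂ | φ.comp (algebraMap F K) = τ ∧ φ ∈ Φ.1}.ncard} := by
    ext F
    simp only [Set.mem_image, Finset.mem_coe, hB, Finset.mem_filter, Finset.mem_univ, true_and,
      Set.mem_setOf_eq]
    constructor
    · rintro ⟨H, ⟨hρH, hidx, hE⟩, rfl⟩
      refine ⟨by rw [← index_eq_finrank_fixedField, hidx],
        (conjGal_not_mem_iff_not_isTotallyReal_fixedField H).1 hρH,
        (forall_card_filter_eq_iff_level φ₀ Φ (fixedField H)).1 ?_⟩
      simpa only [fixingSubgroup_fixedField] using hE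
    · rintro ⟨h2p, hF, hL⟩
      refine ⟨F.fixingSubgroup, ⟨(conjGal_not_mem_fixingSubgroup_iff F).2 hF,
        by rw [CMNumbers.index_fixingSubgroup_eq_finrank, h2p], (forall_card_filter_eq_iff_level φ₀ Φ F).2 hL⟩,
        IsGalois.fixedField_fixingSubgroup F⟩
  rw [← himage, Set.ncard_image_of_injective _ hinj, Set.ncard_coe_finset]

/-- **THE RANK OF A CM TYPE OF AN ABELIAN CM FIELD OF EXPONENT `2p`, ON THE LATTICE OF SUBFIELDS**:
`Rank(Φ) + b(Φ) + (p − 1)·e(Φ) = [K:ℚ]/2 + 1` with `b(Φ) = #{F ⊆ K imaginary quadratic : Φ balanced (Weil type) over F}` and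
`e(Φ) = #{F ⊆ K : [F:ℚ] = 2p, F a CM field, Φ level of exponent p over F}` (for every `σ ∈ Gal(F/ℚ)` of order dividing `p`
and every `τ : F → ℂ`, `#{φ ∈ Φ : φ|_F = τ ∘ σ} = #{φ ∈ Φ : φ|_F = τ}`).  Kubota's defect of `Φ` is `b(Φ) + (p − 1)·e(Φ)`.
[cite: Kubota1965, §4 Lemma 2] [cite: Hazama2003CyclicCM, Prop. 4.3 and Lemma 4.6.1] [cite: Dodson1984, §3.1.1 Theorem]
[cite: Yanai2015IndexDegeneracy, Thm. 4.1 (proof, p. 818)] -/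
theorem cmTypeRank_add_ncard_weilQuadratic_add_mul_ncard_level_eq [Fact p.Prime] (hp2 : p ≠ 2)
    (hexp : ∀ g : K ≃ₐ[ℚ] K, g ^ (2 * p) = 1) (Φ : CMType K) :
    cmTypeRank Φ + {F : IntermediateField ℚ K | Module.finrank ℚ F = 2 ∧ ¬ IsTotallyReal F ∧
        ∀ τ : F →+* ℂ, {φ : K →+* ℂ | φ.comp (algebraMap F K) = τ ∧ φ ∈ Φ.1}.ncard =
          {φ : K →+* ℂ | φ.comp (algebraMap F K) = τ ∧ φ ∉ Φ.1}.ncard}.ncard +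
      (p - 1) * {F : IntermediateField ℚ K | Module.finrank ℚ F = 2 * p ∧ ¬ IsTotallyReal F ∧
        ∀ σ : F ≃ₐ[ℚ] F, σ ^ p = 1 → ∀ τ : F →+* ℂ,
          {φ : K →+* ℂ | φ.comp (algebraMap F K) = τ.comp σ.toRingEquiv.toRingHom ∧ φ ∈ Φ.1}.ncard =
            {φ : K →+* ℂ | φ.comp (algebraMap F K) = τ ∧ φ ∈ Φ.1}.ncard}.ncard = Module.finrank ℚ K / 2 + 1 := by
  obtain ⟨φ₀⟩ := (inferInstance : Nonempty (K →+* ℂ))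
  rw [← card_index_eq_ncard_level φ₀ Φ]
  exact cmTypeRank_add_ncard_weilQuadratic_add_mul_card_eq hp2 φ₀ hexp Φ

/-- **NONDEGENERACY CRITERION ON THE LATTICE OF SUBFIELDS (exponent `2p`).**  `Φ` is nondegenerate iff it is of Weil type
(balanced) over NO imaginary quadratic subfield and level of exponent `p` over NO CM subfield of degree `2p` — an intrinsic
statement (no base embedding, no Galois bookkeeping). [cite: Kubota1965, §4 Lemma 2] [cite: Hazama2003CyclicCM, Prop. 4.3]
[cite: Dodson1984, §3.1.1 Theorem] [cite: Yanai2015IndexDegeneracy, Thm. 4.1] -/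
theorem isNondegenerate_iff_forall_intermediateField [hp : Fact p.Prime] (hp2 : p ≠ 2)
    (hexp : ∀ g : K ≃ₐ[ℚ] K, g ^ (2 * p) = 1) (Φ : CMType K) :
    IsNondegenerate Φ ↔
      (∀ F : IntermediateField ℚ K, Module.finrank ℚ F = 2 → ¬ IsTotallyReal F →
        ¬ ∀ τ : F →+* ℂ, {φ : K →+* ℂ | φ.comp (algebraMap F K) = τ ∧ φ ∈ Φ.1}.ncard =
          {φ : K →+* ℂ | φ.comp (algebraMap F K) = τ ∧ φ ∉ Φ.1}.ncard) ∧
      (∀ F : IntermediateField ℚ K, Module.finrank ℚ F = 2 * p → ¬ IsTotallyReal F →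
        ¬ ∀ σ : F ≃ₐ[ℚ] F, σ ^ p = 1 → ∀ τ : F →+* ℂ,
          {φ : K →+* ℂ | φ.comp (algebraMap F K) = τ.comp σ.toRingEquiv.toRingHom ∧ φ ∈ Φ.1}.ncard =
            {φ : K →+* ℂ | φ.comp (algebraMap F K) = τ ∧ φ ∈ Φ.1}.ncard) := by
  obtain ⟨φ₀⟩ := (inferInstance : Nonempty (K →+* ℂ))
  rw [isNondegenerate_iff hp2 φ₀ hexp Φ]
  refine and_congr_right fun _ => ?_
  constructor
  · intro h F h2p hF hL
    exact h F.fixingSubgroup ((conjGal_not_mem_fixingSubgroup_iff F).2 hF)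
      (by rw [CMNumbers.index_fixingSubgroup_eq_finrank, h2p]) ((forall_card_filter_eq_iff_level φ₀ Φ F).2 hL)
  · intro h H hρH hidx hE
    refine h (fixedField H) (by rw [← index_eq_finrank_fixedField, hidx])
      ((conjGal_not_mem_iff_not_isTotallyReal_fixedField H).1 hρH)
      ((forall_card_filter_eq_iff_level φ₀ Φ (fixedField H)).1 ?_)
    simpa only [fixingSubgroup_fixedField] using hE

end Reading

/-! ## §3 Consequences for abelian varieties: `B•(Aⁿ) ⊗ ℂ = D•(Aⁿ) ⊗ ℂ` and the Hodge conjecture for all powers -/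

section Varieties

open Literature.AlgebraicGeometry.Motives (AbelianVariety)
open Literature.AlgebraicGeometry.HodgeTheory
open Literature.AlgebraicGeometry.ComplexMultiplication (IsCMTypeRealisation)
open Literature.AlgebraicGeometry.VanGeemen1994 (hodgeClassSpan)
open Literature.Barriers.HodgeConjecture (divisorClassesSpan)
open _root_.CategoryTheory _root_.CategoryTheory.Limits

variable {K : Type} [Field K] [NumberField K] [IsCMField K] [IsAbelianGalois ℚ K] {p : ℕ}
  {Φ : CMType K} {A : AbelianVariety ℂ} {ι : 𝓞 K →+* End A} {θ : K →+* Module.End ℂ (complexBetti A.X 1)}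

/-- `Bᵐ ⊗ ℂ = Dᵐ ⊗ ℂ` for all `m` on an abelian variety gives the Hodge conjecture for it (Lefschetz `(1,1)`, cup products, tree
theorems). [cite: Gordon1999HodgeAVSurvey, §9.3] -/
private theorem hodgeConjectureFor_of_forall_hodgeClassSpan_eq₆₄ (B : AbelianVariety ℂ)
    (h : ∀ m : ℕ, hodgeClassSpan B.dim B.X m = divisorClassesSpan B.X B.dim m) : HodgeConjectureFor B.dim B.X :=
  ⟨nonempty_hodgeModel_holds (Motives.AbelianVariety.isSmoothProjective_holds (A := B)),
    fun m _ hc hmm ↦ AbelianVariety.divisorClassesSpan_le_algebraicClasses B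
      (fun b hb hb' ↦ lefschetzOneOne_rational_holds (Motives.AbelianVariety.isSmoothProjective_holds (A := B)) b hb hb') m
      ((h m) ▸ Submodule.subset_span ⟨hc, hmm⟩)⟩

/-- **`B•(Aⁿ) ⊗ ℂ = D•(Aⁿ) ⊗ ℂ` FOR EVERY REALISATION OF A TYPE SATISFYING THE CRITERION.**  `K` abelian CM of exponent
`2p`, `Φ` balanced over no imaginary quadratic subfield and equidistributed at no index-`2p` kernel: `Φ` is nondegenerate,
so for every abelian variety `(A, ι, θ)` of type `(K; Φ)` and all `n, m` the Hodge classes of `Aⁿ` in degree `2m` are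
spanned by products of divisor classes (Hazama's criterion / Pohlmann, tree `IsNondegenerate.hodgeClassSpan_pow_eq_divisorClassesSpan`).
[cite: Kubota1965, §4 Lemma 2] [cite: Gordon1999HodgeAVSurvey, Thm. 6.4 and §9.3] [cite: Hazama2003CyclicCM, Prop. 4.3] -/
theorem hodgeClassSpan_pow_eq_divisorClassesSpan_of_forall [Fact p.Prime] (hp2 : p ≠ 2) (φ₀ : K →+* ℂ)
    (hexp : ∀ g : K ≃ₐ[ℚ] K, g ^ (2 * p) = 1)
    (hW : ∀ F : IntermediateField ℚ K, Module.finrank ℚ F = 2 → ¬ IsTotallyReal F →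
        ¬ ∀ τ : F →+* ℂ, {φ : K →+* ℂ | φ.comp (algebraMap F K) = τ ∧ φ ∈ Φ.1}.ncard =
          {φ : K →+* ℂ | φ.comp (algebraMap F K) = τ ∧ φ ∉ Φ.1}.ncard)
    (hE : ∀ H : Subgroup (K ≃ₐ[ℚ] K), (conjGal : K ≃ₐ[ℚ] K) ∉ H → H.index = 2 * p →
        ¬ ∀ x : K ≃ₐ[ℚ] K, x ^ p ∈ H → ∀ g : K ≃ₐ[ℚ] K,
          ((Finset.univ.filter fun g : K ≃ₐ[ℚ] K => embOf φ₀ g ∈ Φ.1).filter fun s => (g * x)⁻¹ * s ∈ H).card =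
          ((Finset.univ.filter fun g : K ≃ₐ[ℚ] K => embOf φ₀ g ∈ Φ.1).filter fun s => g⁻¹ * s ∈ H).card)
    (hA : IsCMTypeRealisation Φ A ι θ) (n m : ℕ) :
    hodgeClassSpan (⨁ fun _ : Fin n => A).dim (⨁ fun _ : Fin n => A).X m =
      divisorClassesSpan (⨁ fun _ : Fin n => A).X (⨁ fun _ : Fin n => A).dim m :=
  ((isNondegenerate_iff hp2 φ₀ hexp Φ).2 ⟨hW, hE⟩).hodgeClassSpan_pow_eq_divisorClassesSpan hA n m

/-- **THE HODGE CONJECTURE FOR ALL POWERS OF EVERY REALISATION OF A TYPE SATISFYING THE CRITERION** (abelian CM field of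
exponent `2p`; no Weil imaginary quadratic subfield, no equidistributed index-`2p` kernel) — UNCONDITIONAL.
[cite: Gordon1999HodgeAVSurvey, Thm. 6.4 and §9.3] [cite: Kubota1965, §4 Lemma 2] [cite: Deligne2000, §1] -/
theorem hodgeConjectureFor_pow_of_forall [Fact p.Prime] (hp2 : p ≠ 2) (φ₀ : K →+* ℂ)
    (hexp : ∀ g : K ≃ₐ[ℚ] K, g ^ (2 * p) = 1)
    (hW : ∀ F : IntermediateField ℚ K, Module.finrank ℚ F = 2 → ¬ IsTotallyReal F →
        ¬ ∀ τ : F →+* ℂ, {φ : K →+* ℂ | φ.comp (algebraMap F K) = τ ∧ φ ∈ Φ.1}.ncard =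
          {φ : K →+* ℂ | φ.comp (algebraMap F K) = τ ∧ φ ∉ Φ.1}.ncard)
    (hE : ∀ H : Subgroup (K ≃ₐ[ℚ] K), (conjGal : K ≃ₐ[ℚ] K) ∉ H → H.index = 2 * p →
        ¬ ∀ x : K ≃ₐ[ℚ] K, x ^ p ∈ H → ∀ g : K ≃ₐ[ℚ] K,
          ((Finset.univ.filter fun g : K ≃ₐ[ℚ] K => embOf φ₀ g ∈ Φ.1).filter fun s => (g * x)⁻¹ * s ∈ H).card =
          ((Finset.univ.filter fun g : K ≃ₐ[ℚ] K => embOf φ₀ g ∈ Φ.1).filter fun s => g⁻¹ * s ∈ H).card)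
    (hA : IsCMTypeRealisation Φ A ι θ) (n : ℕ) :
    HodgeConjectureFor (⨁ fun _ : Fin n => A).dim (⨁ fun _ : Fin n => A).X :=
  hodgeConjectureFor_of_forall_hodgeClassSpan_eq₆₄ _
    fun m ↦ hodgeClassSpan_pow_eq_divisorClassesSpan_of_forall hp2 φ₀ hexp hW hE hA n m

/-- **Conversely, a Weil imaginary quadratic subfield makes the type DEGENERATE** (any abelian CM field of exponent `2p`; in
fact any CM field — the easy direction, tree `…not_isNondegenerate_of_…`). [cite: Dodson1984, §3.1.1 Theorem]
[cite: Gordon1999HodgeAVSurvey, 5.13 (ii)] -/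
theorem not_isNondegenerate_of_balanced [Fact p.Prime] (hp2 : p ≠ 2)
    (hexp : ∀ g : K ≃ₐ[ℚ] K, g ^ (2 * p) = 1) (Φ : CMType K) (F : IntermediateField ℚ K)
    (h2 : Module.finrank ℚ F = 2) (hF : ¬ IsTotallyReal F)
    (hW : ∀ τ : F →+* ℂ, {φ : K →+* ℂ | φ.comp (algebraMap F K) = τ ∧ φ ∈ Φ.1}.ncard =
      {φ : K →+* ℂ | φ.comp (algebraMap F K) = τ ∧ φ ∉ Φ.1}.ncard) : ¬ IsNondegenerate Φ := by
  obtain ⟨φ₀⟩ := (inferInstance : Nonempty (K →+* ℂ))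
  rw [isNondegenerate_iff hp2 φ₀ hexp Φ]
  exact fun h => h.1 F h2 hF hW

/-- **… and so does an equidistributed index-`2p` kernel.** [cite: Hazama2003CyclicCM, Prop. 4.3 and Lemma 4.6.1]
[cite: Kubota1965, §4 Lemma 2] -/
theorem not_isNondegenerate_of_equidistributed [Fact p.Prime] (hp2 : p ≠ 2) (φ₀ : K →+* ℂ)
    (hexp : ∀ g : K ≃ₐ[ℚ] K, g ^ (2 * p) = 1) (Φ : CMType K) (H : Subgroup (K ≃ₐ[ℚ] K))
    (hρH : (conjGal : K ≃ₐ[ℚ] K) ∉ H) (hidx : H.index = 2 * p)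
    (hEq : ∀ x : K ≃ₐ[ℚ] K, x ^ p ∈ H → ∀ g : K ≃ₐ[ℚ] K,
      ((Finset.univ.filter fun g : K ≃ₐ[ℚ] K => embOf φ₀ g ∈ Φ.1).filter fun s => (g * x)⁻¹ * s ∈ H).card =
      ((Finset.univ.filter fun g : K ≃ₐ[ℚ] K => embOf φ₀ g ∈ Φ.1).filter fun s => g⁻¹ * s ∈ H).card) :
    ¬ IsNondegenerate Φ := by
  rw [isNondegenerate_iff hp2 φ₀ hexp Φ]
  exact fun h => h.2 H hρH hidx hEq

/-- **`B•(Aⁿ) ⊗ ℂ = D•(Aⁿ) ⊗ ℂ`, INTRINSIC FORM**: `K` abelian CM of exponent `2p`; if `Φ` is of Weil type over no imaginary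
quadratic subfield of `K` and level of exponent `p` over no CM subfield of degree `2p`, then every realisation of `(K; Φ)` has
all its Hodge classes on all powers generated by divisor classes. [cite: Kubota1965, §4 Lemma 2]
[cite: Gordon1999HodgeAVSurvey, Thm. 6.4 and §9.3] [cite: Hazama2003CyclicCM, Prop. 4.3] -/
theorem hodgeClassSpan_pow_eq_divisorClassesSpan_of_forall_intermediateField [Fact p.Prime] (hp2 : p ≠ 2)
    (hexp : ∀ g : K ≃ₐ[ℚ] K, g ^ (2 * p) = 1)
    (hW : ∀ F : IntermediateField ℚ K, Module.finrank ℚ F = 2 → ¬ IsTotallyReal F →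
        ¬ ∀ τ : F →+* ℂ, {φ : K →+* ℂ | φ.comp (algebraMap F K) = τ ∧ φ ∈ Φ.1}.ncard =
          {φ : K →+* ℂ | φ.comp (algebraMap F K) = τ ∧ φ ∉ Φ.1}.ncard)
    (hL : ∀ F : IntermediateField ℚ K, Module.finrank ℚ F = 2 * p → ¬ IsTotallyReal F →
        ¬ ∀ σ : F ≃ₐ[ℚ] F, σ ^ p = 1 → ∀ τ : F →+* ℂ,
          {φ : K →+* ℂ | φ.comp (algebraMap F K) = τ.comp σ.toRingEquiv.toRingHom ∧ φ ∈ Φ.1}.ncard =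
            {φ : K →+* ℂ | φ.comp (algebraMap F K) = τ ∧ φ ∈ Φ.1}.ncard)
    (hA : IsCMTypeRealisation Φ A ι θ) (n m : ℕ) :
    hodgeClassSpan (⨁ fun _ : Fin n => A).dim (⨁ fun _ : Fin n => A).X m =
      divisorClassesSpan (⨁ fun _ : Fin n => A).X (⨁ fun _ : Fin n => A).dim m :=
  ((isNondegenerate_iff_forall_intermediateField hp2 hexp Φ).2 ⟨hW, hL⟩).hodgeClassSpan_pow_eq_divisorClassesSpan hA n m

/-- **THE HODGE CONJECTURE FOR ALL POWERS, INTRINSIC FORM** (abelian CM field of exponent `2p`; `Φ` of Weil type over no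
imaginary quadratic subfield and level over no CM subfield of degree `2p`) — UNCONDITIONAL, any realisation.
[cite: Gordon1999HodgeAVSurvey, Thm. 6.4 and §9.3] [cite: Kubota1965, §4 Lemma 2] [cite: Deligne2000, §1] -/
theorem hodgeConjectureFor_pow_of_forall_intermediateField [Fact p.Prime] (hp2 : p ≠ 2)
    (hexp : ∀ g : K ≃ₐ[ℚ] K, g ^ (2 * p) = 1)
    (hW : ∀ F : IntermediateField ℚ K, Module.finrank ℚ F = 2 → ¬ IsTotallyReal F →
        ¬ ∀ τ : F →+* ℂ, {φ : K →+* ℂ | φ.comp (algebraMap F K) = τ ∧ φ ∈ Φ.1}.ncard =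
          {φ : K →+* ℂ | φ.comp (algebraMap F K) = τ ∧ φ ∉ Φ.1}.ncard)
    (hL : ∀ F : IntermediateField ℚ K, Module.finrank ℚ F = 2 * p → ¬ IsTotallyReal F →
        ¬ ∀ σ : F ≃ₐ[ℚ] F, σ ^ p = 1 → ∀ τ : F →+* ℂ,
          {φ : K →+* ℂ | φ.comp (algebraMap F K) = τ.comp σ.toRingEquiv.toRingHom ∧ φ ∈ Φ.1}.ncard =
            {φ : K →+* ℂ | φ.comp (algebraMap F K) = τ ∧ φ ∈ Φ.1}.ncard)
    (hA : IsCMTypeRealisation Φ A ι θ) (n : ℕ) :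
    HodgeConjectureFor (⨁ fun _ : Fin n => A).dim (⨁ fun _ : Fin n => A).X :=
  hodgeConjectureFor_of_forall_hodgeClassSpan_eq₆₄ _
    fun m ↦ hodgeClassSpan_pow_eq_divisorClassesSpan_of_forall_intermediateField hp2 hexp hW hL hA n m

/-- **No power of such an `A` carries an exceptional Hodge class** (a rational `(m,m)`-class outside `Dᵐ ⊗ ℂ`).
[cite: Gordon1999HodgeAVSurvey, Thm. 6.4] -/
theorem not_exists_exceptional_pow_of_forall_intermediateField [Fact p.Prime] (hp2 : p ≠ 2)
    (hexp : ∀ g : K ≃ₐ[ℚ] K, g ^ (2 * p) = 1)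
    (hW : ∀ F : IntermediateField ℚ K, Module.finrank ℚ F = 2 → ¬ IsTotallyReal F →
        ¬ ∀ τ : F →+* ℂ, {φ : K →+* ℂ | φ.comp (algebraMap F K) = τ ∧ φ ∈ Φ.1}.ncard =
          {φ : K →+* ℂ | φ.comp (algebraMap F K) = τ ∧ φ ∉ Φ.1}.ncard)
    (hL : ∀ F : IntermediateField ℚ K, Module.finrank ℚ F = 2 * p → ¬ IsTotallyReal F →
        ¬ ∀ σ : F ≃ₐ[ℚ] F, σ ^ p = 1 → ∀ τ : F →+* ℂ,
          {φ : K →+* ℂ | φ.comp (algebraMap F K) = τ.comp σ.toRingEquiv.toRingHom ∧ φ ∈ Φ.1}.ncard =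
            {φ : K →+* ℂ | φ.comp (algebraMap F K) = τ ∧ φ ∈ Φ.1}.ncard)
    (hA : IsCMTypeRealisation Φ A ι θ) (n m : ℕ) :
    ¬ ∃ c : complexBetti (⨁ fun _ : Fin n => A).X (2 * m), IsRationalClass c ∧
        IsOfHodgeType (⨁ fun _ : Fin n => A).dim (⨁ fun _ : Fin n => A).X (2 * m) m m c ∧
        c ∉ divisorClassesSpan (⨁ fun _ : Fin n => A).X (⨁ fun _ : Fin n => A).dim m := by
  rintro ⟨c, hcQ, hcH, hcD⟩
  exact hcD ((hodgeClassSpan_pow_eq_divisorClassesSpan_of_forall_intermediateField hp2 hexp hW hL hA n m) ▸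
    Submodule.subset_span ⟨hcQ, hcH⟩)

end Varieties

/-! ## §4 The cyclotomic fields `ℚ(ζ_q)` with `(ℤ/q)ˣ` of exponent `2p`: `q = 56, 72, 84` (`(ℤ/2)² × ℤ/6`, `φ = 24`) -/

section Cyclotomic

open Literature.AlgebraicGeometry.Motives (AbelianVariety)
open Literature.AlgebraicGeometry.HodgeTheory
open Literature.AlgebraicGeometry.ComplexMultiplication (IsCMTypeRealisation)
open Literature.AlgebraicGeometry.VanGeemen1994 (hodgeClassSpan)
open Literature.Barriers.HodgeConjecture (divisorClassesSpan)
open _root_.CategoryTheory _root_.CategoryTheory.Limits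
open Polynomial

variable {q p : ℕ} {L : Type} [Field L] [NumberField L]
  {Φ : CMType L} {A : AbelianVariety ℂ} {ι : 𝓞 L →+* End A} {θ : L →+* Module.End ℂ (complexBetti A.X 1)}

/-- For `L ≅ ℚ(ζ_q)` (`q > 2`) with `u^{2p} = 1` for every `u ∈ (ℤ/q)ˣ`: `L` is a CM field, abelian over `ℚ`, with
`g^{2p} = 1` for every `g ∈ Gal(L/ℚ) ≅ (ℤ/q)ˣ`, and `[L:ℚ] = φ(q)`. [cite: Washington1997, Ch. 2 Thm. 2.5] -/
theorem cm_abelian_pow_eq_one_of_isCyclotomicExtension [NeZero q] (h2q : 2 < q) (hq : ∀ u : (ZMod q)ˣ, u ^ (2 * p) = 1)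
    (L : Type) [Field L] [NumberField L] [IsCyclotomicExtension {q} ℚ L] :
    IsCMField L ∧ IsAbelianGalois ℚ L ∧ (∀ g : L ≃ₐ[ℚ] L, g ^ (2 * p) = 1) ∧ Module.finrank ℚ L = Nat.totient q := by
  have hirr : Irreducible (cyclotomic q ℚ) := cyclotomic.irreducible_rat (NeZero.pos q)
  refine ⟨IsCyclotomicExtension.Rat.isCMField L (S := ({q} : Set ℕ)) ⟨q, rfl, h2q⟩,
    IsCyclotomicExtension.isAbelianGalois {q} ℚ L, fun g => ?_, IsCyclotomicExtension.finrank L hirr⟩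
  exact (IsCyclotomicExtension.autEquivPow L hirr).injective (by rw [map_pow, hq, map_one])

/-- **The rank formula for `ℚ(ζ_q)`, `(ℤ/q)ˣ` of exponent `2p`**: `Rank(Φ) + b(Φ) + (p − 1)·e(Φ) = φ(q)/2 + 1`.
[cite: Kubota1965, §4 Lemma 2] [cite: Hazama2003CyclicCM, Prop. 4.3] [cite: Dodson1984, §3.1.1 Theorem] -/
theorem cmTypeRank_add_ncard_add_mul_ncard_eq_of_isCyclotomicExtension [NeZero q] [IsCyclotomicExtension {q} ℚ L]
    (h2q : 2 < q) [Fact p.Prime] (hp2 : p ≠ 2) (hq : ∀ u : (ZMod q)ˣ, u ^ (2 * p) = 1) (Φ : CMType L) :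
    cmTypeRank Φ + {F : IntermediateField ℚ L | Module.finrank ℚ F = 2 ∧ ¬ IsTotallyReal F ∧
        ∀ τ : F →+* ℂ, {φ : L →+* ℂ | φ.comp (algebraMap F L) = τ ∧ φ ∈ Φ.1}.ncard =
          {φ : L →+* ℂ | φ.comp (algebraMap F L) = τ ∧ φ ∉ Φ.1}.ncard}.ncard +
      (p - 1) * {F : IntermediateField ℚ L | Module.finrank ℚ F = 2 * p ∧ ¬ IsTotallyReal F ∧
        ∀ σ : F ≃ₐ[ℚ] F, σ ^ p = 1 → ∀ τ : F →+* ℂ,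
          {φ : L →+* ℂ | φ.comp (algebraMap F L) = τ.comp σ.toRingEquiv.toRingHom ∧ φ ∈ Φ.1}.ncard =
            {φ : L →+* ℂ | φ.comp (algebraMap F L) = τ ∧ φ ∈ Φ.1}.ncard}.ncard = Nat.totient q / 2 + 1 := by
  obtain ⟨hcm, hab, hexp, hL⟩ := cm_abelian_pow_eq_one_of_isCyclotomicExtension h2q hq L
  haveI := hcm; haveI := hab
  rw [← hL]
  exact cmTypeRank_add_ncard_weilQuadratic_add_mul_ncard_level_eq hp2 hexp Φ

/-- **Nondegeneracy criterion for `ℚ(ζ_q)`, `(ℤ/q)ˣ` of exponent `2p`**: no Weil imaginary quadratic subfield, no CM subfield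
of degree `2p` over which `Φ` is level. [cite: Kubota1965, §4 Lemma 2] [cite: Hazama2003CyclicCM, Prop. 4.3]
[cite: Dodson1984, §3.1.1 Theorem] -/
theorem isNondegenerate_iff_of_isCyclotomicExtension [NeZero q] [IsCyclotomicExtension {q} ℚ L]
    (h2q : 2 < q) [Fact p.Prime] (hp2 : p ≠ 2) (hq : ∀ u : (ZMod q)ˣ, u ^ (2 * p) = 1) (Φ : CMType L) :
    IsNondegenerate Φ ↔
      (∀ F : IntermediateField ℚ L, Module.finrank ℚ F = 2 → ¬ IsTotallyReal F →
        ¬ ∀ τ : F →+* ℂ, {φ : L →+* ℂ | φ.comp (algebraMap F L) = τ ∧ φ ∈ Φ.1}.ncard =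
          {φ : L →+* ℂ | φ.comp (algebraMap F L) = τ ∧ φ ∉ Φ.1}.ncard) ∧
      (∀ F : IntermediateField ℚ L, Module.finrank ℚ F = 2 * p → ¬ IsTotallyReal F →
        ¬ ∀ σ : F ≃ₐ[ℚ] F, σ ^ p = 1 → ∀ τ : F →+* ℂ,
          {φ : L →+* ℂ | φ.comp (algebraMap F L) = τ.comp σ.toRingEquiv.toRingHom ∧ φ ∈ Φ.1}.ncard =
            {φ : L →+* ℂ | φ.comp (algebraMap F L) = τ ∧ φ ∈ Φ.1}.ncard) := by
  obtain ⟨hcm, hab, hexp, -⟩ := cm_abelian_pow_eq_one_of_isCyclotomicExtension h2q hq L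
  haveI := hcm; haveI := hab
  exact isNondegenerate_iff_forall_intermediateField hp2 hexp Φ

/-- **The Hodge conjecture for all powers of every realisation of a type of `ℚ(ζ_q)`** (`(ℤ/q)ˣ` of exponent `2p`) **of Weil
type over no imaginary quadratic subfield and level over no CM subfield of degree `2p`** — UNCONDITIONAL.
[cite: Gordon1999HodgeAVSurvey, Thm. 6.4 and §9.3] [cite: Kubota1965, §4 Lemma 2] -/
theorem hodgeConjectureFor_pow_of_forall_of_isCyclotomicExtension [NeZero q] [IsCyclotomicExtension {q} ℚ L]
    (h2q : 2 < q) [Fact p.Prime] (hp2 : p ≠ 2) (hq : ∀ u : (ZMod q)ˣ, u ^ (2 * p) = 1)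
    (hW : ∀ F : IntermediateField ℚ L, Module.finrank ℚ F = 2 → ¬ IsTotallyReal F →
        ¬ ∀ τ : F →+* ℂ, {φ : L →+* ℂ | φ.comp (algebraMap F L) = τ ∧ φ ∈ Φ.1}.ncard =
          {φ : L →+* ℂ | φ.comp (algebraMap F L) = τ ∧ φ ∉ Φ.1}.ncard)
    (hL : ∀ F : IntermediateField ℚ L, Module.finrank ℚ F = 2 * p → ¬ IsTotallyReal F →
        ¬ ∀ σ : F ≃ₐ[ℚ] F, σ ^ p = 1 → ∀ τ : F →+* ℂ,
          {φ : L →+* ℂ | φ.comp (algebraMap F L) = τ.comp σ.toRingEquiv.toRingHom ∧ φ ∈ Φ.1}.ncard =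
            {φ : L →+* ℂ | φ.comp (algebraMap F L) = τ ∧ φ ∈ Φ.1}.ncard)
    (hA : IsCMTypeRealisation Φ A ι θ) (n : ℕ) :
    HodgeConjectureFor (⨁ fun _ : Fin n => A).dim (⨁ fun _ : Fin n => A).X := by
  obtain ⟨hcm, hab, hexp, -⟩ := cm_abelian_pow_eq_one_of_isCyclotomicExtension h2q hq L
  haveI := hcm; haveI := hab
  exact hodgeConjectureFor_pow_of_forall_intermediateField hp2 hexp hW hL hA n

/-! ### The levels `56`, `72`, `84` (and, again, `21, 28, 36, 42` and `33, 44, 66`) -/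

/-- `u⁶ = 1` for every unit of `ℤ/56`: `(ℤ/56)ˣ ≅ (ℤ/2)² × ℤ/6` (kernel decision on residues coprime to `56`).
[cite: Washington1997, Ch. 2 Thm. 2.5] -/
theorem units_pow_six_fiftySix (u : (ZMod 56)ˣ) : u ^ (2 * 3) = 1 := by
  have h : ∀ a : ZMod 56, Nat.Coprime a.val 56 → a ^ 6 = 1 := by decide
  exact Units.ext (by rw [Units.val_pow_eq_pow_val, h _ (ZMod.val_coe_unit_coprime u), Units.val_one])

/-- `u⁶ = 1` for every unit of `ℤ/72`: `(ℤ/72)ˣ ≅ (ℤ/2)² × ℤ/6`. [cite: Washington1997, Ch. 2 Thm. 2.5] -/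
theorem units_pow_six_seventyTwo (u : (ZMod 72)ˣ) : u ^ (2 * 3) = 1 := by
  have h : ∀ a : ZMod 72, Nat.Coprime a.val 72 → a ^ 6 = 1 := by decide
  exact Units.ext (by rw [Units.val_pow_eq_pow_val, h _ (ZMod.val_coe_unit_coprime u), Units.val_one])

/-- `u⁶ = 1` for every unit of `ℤ/84`: `(ℤ/84)ˣ ≅ (ℤ/2)² × ℤ/6`. [cite: Washington1997, Ch. 2 Thm. 2.5] -/
theorem units_pow_six_eightyFour (u : (ZMod 84)ˣ) : u ^ (2 * 3) = 1 := by
  have h : ∀ a : ZMod 84, Nat.Coprime a.val 84 → a ^ 6 = 1 := by decide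
  exact Units.ext (by rw [Units.val_pow_eq_pow_val, h _ (ZMod.val_coe_unit_coprime u), Units.val_one])

/-- **`ℚ(ζ₅₆)` (degree `24`, `Gal ≅ (ℤ/2)² × ℤ/6`): the rank formula `Rank(Φ) + b(Φ) + 2·e(Φ) = 13`** for every CM type —
`b` = number of the imaginary quadratic subfields (`ℚ(√-1), ℚ(√-2), ℚ(√-7), ℚ(√-14)`) over which `Φ` is of Weil type, `e` =
number of the (cyclic sextic) CM subfields over which `Φ` is level of exponent `3`. [cite: Kubota1965, §4 Lemma 2]
[cite: Hazama2003CyclicCM, Prop. 4.3] [cite: Dodson1984, §3.1.1 Theorem] -/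
theorem cmTypeRank_add_ncard_add_two_mul_ncard_fiftySix [IsCyclotomicExtension {56} ℚ L] (Φ : CMType L) :
    cmTypeRank Φ + {F : IntermediateField ℚ L | Module.finrank ℚ F = 2 ∧ ¬ IsTotallyReal F ∧
        ∀ τ : F →+* ℂ, {φ : L →+* ℂ | φ.comp (algebraMap F L) = τ ∧ φ ∈ Φ.1}.ncard =
          {φ : L →+* ℂ | φ.comp (algebraMap F L) = τ ∧ φ ∉ Φ.1}.ncard}.ncard +
      2 * {F : IntermediateField ℚ L | Module.finrank ℚ F = 6 ∧ ¬ IsTotallyReal F ∧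
        ∀ σ : F ≃ₐ[ℚ] F, σ ^ (3 : ℕ) = AlgEquiv.refl → ∀ τ : F →+* ℂ,
          {φ : L →+* ℂ | φ.comp (algebraMap F L) = τ.comp σ.toRingEquiv.toRingHom ∧ φ ∈ Φ.1}.ncard =
            {φ : L →+* ℂ | φ.comp (algebraMap F L) = τ ∧ φ ∈ Φ.1}.ncard}.ncard = 13 := by
  haveI : Fact (Nat.Prime 3) := ⟨Nat.prime_three⟩
  have h := cmTypeRank_add_ncard_add_mul_ncard_eq_of_isCyclotomicExtension (L := L) (q := 56) (by norm_num)
    (by decide : (3 : ℕ) ≠ 2) units_pow_six_fiftySix Φ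
  have h56 : Nat.totient 56 = 24 := by decide
  rw [h56] at h
  exact h

/-- **`ℚ(ζ₅₆)`: THE HODGE CONJECTURE FOR ALL POWERS of every abelian variety with complex multiplication by `ℚ(ζ₅₆)`
(CM `12`-folds) whose type is of Weil type over none of the imaginary quadratic subfields and level over none of the
sextic CM subfields** — UNCONDITIONAL. [cite: Gordon1999HodgeAVSurvey, Thm. 6.4 and §9.3] [cite: Kubota1965, §4 Lemma 2] -/
theorem hodgeConjectureFor_pow_of_forall_fiftySix [IsCyclotomicExtension {56} ℚ L]
    (hW : ∀ F : IntermediateField ℚ L, Module.finrank ℚ F = 2 → ¬ IsTotallyReal F →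
        ¬ ∀ τ : F →+* ℂ, {φ : L →+* ℂ | φ.comp (algebraMap F L) = τ ∧ φ ∈ Φ.1}.ncard =
          {φ : L →+* ℂ | φ.comp (algebraMap F L) = τ ∧ φ ∉ Φ.1}.ncard)
    (hL : ∀ F : IntermediateField ℚ L, Module.finrank ℚ F = 2 * 3 → ¬ IsTotallyReal F →
        ¬ ∀ σ : F ≃ₐ[ℚ] F, σ ^ (3 : ℕ) = AlgEquiv.refl → ∀ τ : F →+* ℂ,
          {φ : L →+* ℂ | φ.comp (algebraMap F L) = τ.comp σ.toRingEquiv.toRingHom ∧ φ ∈ Φ.1}.ncard =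
            {φ : L →+* ℂ | φ.comp (algebraMap F L) = τ ∧ φ ∈ Φ.1}.ncard)
    (hA : IsCMTypeRealisation Φ A ι θ) (n : ℕ) :
    HodgeConjectureFor (⨁ fun _ : Fin n => A).dim (⨁ fun _ : Fin n => A).X :=
  haveI : Fact (Nat.Prime 3) := ⟨Nat.prime_three⟩
  hodgeConjectureFor_pow_of_forall_of_isCyclotomicExtension (q := 56) (by norm_num) (by decide) units_pow_six_fiftySix
    hW hL hA n

/-- **`ℚ(ζ₇₂)` (degree `24`, `Gal ≅ (ℤ/2)² × ℤ/6`): `Rank(Φ) + b(Φ) + 2·e(Φ) = 13`.** [cite: Kubota1965, §4 Lemma 2]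
[cite: Hazama2003CyclicCM, Prop. 4.3] [cite: Dodson1984, §3.1.1 Theorem] -/
theorem cmTypeRank_add_ncard_add_two_mul_ncard_seventyTwo [IsCyclotomicExtension {72} ℚ L] (Φ : CMType L) :
    cmTypeRank Φ + {F : IntermediateField ℚ L | Module.finrank ℚ F = 2 ∧ ¬ IsTotallyReal F ∧
        ∀ τ : F →+* ℂ, {φ : L →+* ℂ | φ.comp (algebraMap F L) = τ ∧ φ ∈ Φ.1}.ncard =
          {φ : L →+* ℂ | φ.comp (algebraMap F L) = τ ∧ φ ∉ Φ.1}.ncard}.ncard +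
      2 * {F : IntermediateField ℚ L | Module.finrank ℚ F = 6 ∧ ¬ IsTotallyReal F ∧
        ∀ σ : F ≃ₐ[ℚ] F, σ ^ (3 : ℕ) = AlgEquiv.refl → ∀ τ : F →+* ℂ,
          {φ : L →+* ℂ | φ.comp (algebraMap F L) = τ.comp σ.toRingEquiv.toRingHom ∧ φ ∈ Φ.1}.ncard =
            {φ : L →+* ℂ | φ.comp (algebraMap F L) = τ ∧ φ ∈ Φ.1}.ncard}.ncard = 13 := by
  haveI : Fact (Nat.Prime 3) := ⟨Nat.prime_three⟩
  have h := cmTypeRank_add_ncard_add_mul_ncard_eq_of_isCyclotomicExtension (L := L) (q := 72) (by norm_num)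
    (by decide : (3 : ℕ) ≠ 2) units_pow_six_seventyTwo Φ
  have h72 : Nat.totient 72 = 24 := by decide
  rw [h72] at h
  exact h

/-- **`ℚ(ζ₇₂)`: the Hodge conjecture for all powers of every realisation of a type of Weil type over no imaginary quadratic
subfield and level over no sextic CM subfield** — UNCONDITIONAL. [cite: Gordon1999HodgeAVSurvey, Thm. 6.4 and §9.3]
[cite: Kubota1965, §4 Lemma 2] -/
theorem hodgeConjectureFor_pow_of_forall_seventyTwo [IsCyclotomicExtension {72} ℚ L]
    (hW : ∀ F : IntermediateField ℚ L, Module.finrank ℚ F = 2 → ¬ IsTotallyReal F →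
        ¬ ∀ τ : F →+* ℂ, {φ : L →+* ℂ | φ.comp (algebraMap F L) = τ ∧ φ ∈ Φ.1}.ncard =
          {φ : L →+* ℂ | φ.comp (algebraMap F L) = τ ∧ φ ∉ Φ.1}.ncard)
    (hL : ∀ F : IntermediateField ℚ L, Module.finrank ℚ F = 2 * 3 → ¬ IsTotallyReal F →
        ¬ ∀ σ : F ≃ₐ[ℚ] F, σ ^ (3 : ℕ) = AlgEquiv.refl → ∀ τ : F →+* ℂ,
          {φ : L →+* ℂ | φ.comp (algebraMap F L) = τ.comp σ.toRingEquiv.toRingHom ∧ φ ∈ Φ.1}.ncard =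
            {φ : L →+* ℂ | φ.comp (algebraMap F L) = τ ∧ φ ∈ Φ.1}.ncard)
    (hA : IsCMTypeRealisation Φ A ι θ) (n : ℕ) :
    HodgeConjectureFor (⨁ fun _ : Fin n => A).dim (⨁ fun _ : Fin n => A).X :=
  haveI : Fact (Nat.Prime 3) := ⟨Nat.prime_three⟩
  hodgeConjectureFor_pow_of_forall_of_isCyclotomicExtension (q := 72) (by norm_num) (by decide) units_pow_six_seventyTwo
    hW hL hA n

/-- **`ℚ(ζ₈₄)` (degree `24`, `Gal ≅ (ℤ/2)² × ℤ/6`): `Rank(Φ) + b(Φ) + 2·e(Φ) = 13`.** [cite: Kubota1965, §4 Lemma 2]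
[cite: Hazama2003CyclicCM, Prop. 4.3] [cite: Dodson1984, §3.1.1 Theorem] -/
theorem cmTypeRank_add_ncard_add_two_mul_ncard_eightyFour [IsCyclotomicExtension {84} ℚ L] (Φ : CMType L) :
    cmTypeRank Φ + {F : IntermediateField ℚ L | Module.finrank ℚ F = 2 ∧ ¬ IsTotallyReal F ∧
        ∀ τ : F →+* ℂ, {φ : L →+* ℂ | φ.comp (algebraMap F L) = τ ∧ φ ∈ Φ.1}.ncard =
          {φ : L →+* ℂ | φ.comp (algebraMap F L) = τ ∧ φ ∉ Φ.1}.ncard}.ncard +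
      2 * {F : IntermediateField ℚ L | Module.finrank ℚ F = 6 ∧ ¬ IsTotallyReal F ∧
        ∀ σ : F ≃ₐ[ℚ] F, σ ^ (3 : ℕ) = AlgEquiv.refl → ∀ τ : F →+* ℂ,
          {φ : L →+* ℂ | φ.comp (algebraMap F L) = τ.comp σ.toRingEquiv.toRingHom ∧ φ ∈ Φ.1}.ncard =
            {φ : L →+* ℂ | φ.comp (algebraMap F L) = τ ∧ φ ∈ Φ.1}.ncard}.ncard = 13 := by
  haveI : Fact (Nat.Prime 3) := ⟨Nat.prime_three⟩
  have h := cmTypeRank_add_ncard_add_mul_ncard_eq_of_isCyclotomicExtension (L := L) (q := 84) (by norm_num)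
    (by decide : (3 : ℕ) ≠ 2) units_pow_six_eightyFour Φ
  have h84 : Nat.totient 84 = 24 := by decide
  rw [h84] at h
  exact h

/-- **`ℚ(ζ₈₄)`: the Hodge conjecture for all powers of every realisation of a type of Weil type over no imaginary quadratic
subfield and level over no sextic CM subfield** — UNCONDITIONAL. [cite: Gordon1999HodgeAVSurvey, Thm. 6.4 and §9.3]
[cite: Kubota1965, §4 Lemma 2] -/
theorem hodgeConjectureFor_pow_of_forall_eightyFour [IsCyclotomicExtension {84} ℚ L]
    (hW : ∀ F : IntermediateField ℚ L, Module.finrank ℚ F = 2 → ¬ IsTotallyReal F →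
        ¬ ∀ τ : F →+* ℂ, {φ : L →+* ℂ | φ.comp (algebraMap F L) = τ ∧ φ ∈ Φ.1}.ncard =
          {φ : L →+* ℂ | φ.comp (algebraMap F L) = τ ∧ φ ∉ Φ.1}.ncard)
    (hL : ∀ F : IntermediateField ℚ L, Module.finrank ℚ F = 2 * 3 → ¬ IsTotallyReal F →
        ¬ ∀ σ : F ≃ₐ[ℚ] F, σ ^ (3 : ℕ) = AlgEquiv.refl → ∀ τ : F →+* ℂ,
          {φ : L →+* ℂ | φ.comp (algebraMap F L) = τ.comp σ.toRingEquiv.toRingHom ∧ φ ∈ Φ.1}.ncard =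
            {φ : L →+* ℂ | φ.comp (algebraMap F L) = τ ∧ φ ∈ Φ.1}.ncard)
    (hA : IsCMTypeRealisation Φ A ι θ) (n : ℕ) :
    HodgeConjectureFor (⨁ fun _ : Fin n => A).dim (⨁ fun _ : Fin n => A).X :=
  haveI : Fact (Nat.Prime 3) := ⟨Nat.prime_three⟩
  hodgeConjectureFor_pow_of_forall_of_isCyclotomicExtension (q := 84) (by norm_num) (by decide) units_pow_six_eightyFour
    hW hL hA n

/-! ### The level `63` (`ℚ(ζ₆₃) = ℚ(ζ₁₂₆)`, degree `36`, `(ℤ/63)ˣ ≅ ℤ/6 × ℤ/6`): exponent `6` again — appended in generation 64 with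
the lane's «φ(N) = 36» files (`ExponentTwicePrimeSquare`: `57, 76, 108`) -/

/-- `u⁶ = 1` for every unit of `ℤ/63`: `(ℤ/63)ˣ ≅ (ℤ/7)ˣ × (ℤ/9)ˣ ≅ ℤ/6 × ℤ/6` (kernel decision on the residues coprime to `63`).
[cite: Washington1997, Ch. 2 Thm. 2.5] -/
theorem units_pow_six_sixtyThree (u : (ZMod 63)ˣ) : u ^ (2 * 3) = 1 := by
  have h : ∀ a : ZMod 63, Nat.Coprime a.val 63 → a ^ 6 = 1 := by decide
  exact Units.ext (by rw [Units.val_pow_eq_pow_val, h _ (ZMod.val_coe_unit_coprime u), Units.val_one])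

/-- **`ℚ(ζ₆₃)` (degree `36`, `Gal ≅ ℤ/6 × ℤ/6 ≅ (ℤ/2)² × (ℤ/3)²`): the rank formula `Rank(Φ) + b(Φ) + 2·e(Φ) = 19`** for every CM type —
`b` = the number of imaginary quadratic subfields (`ℚ(√-3), ℚ(√-7)`; `ℚ(√21)` is real) over which `Φ` is of Weil type, `e` = the number of
(cyclic) sextic CM subfields over which `Φ` is level of exponent `3`. [cite: Kubota1965, §4 Lemma 2] [cite: Hazama2003CyclicCM, Prop. 4.3]
[cite: Dodson1984, §3.1.1 Theorem] -/
theorem cmTypeRank_add_ncard_add_two_mul_ncard_sixtyThree [IsCyclotomicExtension {63} ℚ L] (Φ : CMType L) :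
    cmTypeRank Φ + {F : IntermediateField ℚ L | Module.finrank ℚ F = 2 ∧ ¬ IsTotallyReal F ∧
        ∀ τ : F →+* ℂ, {φ : L →+* ℂ | φ.comp (algebraMap F L) = τ ∧ φ ∈ Φ.1}.ncard =
          {φ : L →+* ℂ | φ.comp (algebraMap F L) = τ ∧ φ ∉ Φ.1}.ncard}.ncard +
      2 * {F : IntermediateField ℚ L | Module.finrank ℚ F = 6 ∧ ¬ IsTotallyReal F ∧
        ∀ σ : F ≃ₐ[ℚ] F, σ ^ (3 : ℕ) = AlgEquiv.refl → ∀ τ : F →+* ℂ,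
          {φ : L →+* ℂ | φ.comp (algebraMap F L) = τ.comp σ.toRingEquiv.toRingHom ∧ φ ∈ Φ.1}.ncard =
            {φ : L →+* ℂ | φ.comp (algebraMap F L) = τ ∧ φ ∈ Φ.1}.ncard}.ncard = 19 := by
  haveI : Fact (Nat.Prime 3) := ⟨Nat.prime_three⟩
  have h := cmTypeRank_add_ncard_add_mul_ncard_eq_of_isCyclotomicExtension (L := L) (q := 63) (by norm_num)
    (by decide : (3 : ℕ) ≠ 2) units_pow_six_sixtyThree Φ
  have h63 : Nat.totient 63 = 36 := by decide
  rw [h63] at h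
  exact h

/-- **`ℚ(ζ₆₃)`: THE HODGE CONJECTURE FOR ALL POWERS of every abelian variety with complex multiplication by `ℚ(ζ₆₃)` (CM `18`-folds)
whose type is of Weil type over neither imaginary quadratic subfield and level of exponent `3` over none of the sextic CM subfields** —
UNCONDITIONAL. [cite: Gordon1999HodgeAVSurvey, Thm. 6.4 and §9.3] [cite: Kubota1965, §4 Lemma 2] -/
theorem hodgeConjectureFor_pow_of_forall_sixtyThree [IsCyclotomicExtension {63} ℚ L]
    (hW : ∀ F : IntermediateField ℚ L, Module.finrank ℚ F = 2 → ¬ IsTotallyReal F →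
        ¬ ∀ τ : F →+* ℂ, {φ : L →+* ℂ | φ.comp (algebraMap F L) = τ ∧ φ ∈ Φ.1}.ncard =
          {φ : L →+* ℂ | φ.comp (algebraMap F L) = τ ∧ φ ∉ Φ.1}.ncard)
    (hL : ∀ F : IntermediateField ℚ L, Module.finrank ℚ F = 2 * 3 → ¬ IsTotallyReal F →
        ¬ ∀ σ : F ≃ₐ[ℚ] F, σ ^ (3 : ℕ) = AlgEquiv.refl → ∀ τ : F →+* ℂ,
          {φ : L →+* ℂ | φ.comp (algebraMap F L) = τ.comp σ.toRingEquiv.toRingHom ∧ φ ∈ Φ.1}.ncard =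
            {φ : L →+* ℂ | φ.comp (algebraMap F L) = τ ∧ φ ∈ Φ.1}.ncard)
    (hA : IsCMTypeRealisation Φ A ι θ) (n : ℕ) :
    HodgeConjectureFor (⨁ fun _ : Fin n => A).dim (⨁ fun _ : Fin n => A).X :=
  haveI : Fact (Nat.Prime 3) := ⟨Nat.prime_three⟩
  hodgeConjectureFor_pow_of_forall_of_isCyclotomicExtension (q := 63) (by norm_num) (by decide) units_pow_six_sixtyThree
    hW hL hA n

/-! ### The levels `88, 132` (`(ℤ/q)ˣ ≅ (ℤ/2)² × ℤ/10`, `φ(q) = 40`): exponent `10` — appended in generation 64 with the «φ(N) = 40» instances -/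

/-- `u¹⁰ = 1` for every unit of `ℤ/88`: `(ℤ/88)ˣ ≅ (ℤ/2)² × ℤ/10` (kernel decision on the residues coprime to `88`).
[cite: Washington1997, Ch. 2 Thm. 2.5] -/
theorem units_pow_ten_eightyEight (u : (ZMod 88)ˣ) : u ^ (2 * 5) = 1 := by
  have h : ∀ a : ZMod 88, Nat.Coprime a.val 88 → a ^ 10 = 1 := by decide +kernel
  rw [show (2 * 5 : ℕ) = 10 by norm_num]
  exact Units.ext (by rw [Units.val_pow_eq_pow_val, h _ (ZMod.val_coe_unit_coprime u), Units.val_one])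

/-- **`ℚ(ζ₈₈)` (degree `40`, `Gal ≅ (ℤ/2)² × ℤ/10`): the rank formula `Rank(Φ) + b(Φ) + 4·e(Φ) = 21`** for every CM type — `b` = the number of
imaginary quadratic subfields over which `Φ` is of Weil type, `e` = the number of (cyclic) CM subfields of degree `10` over which `Φ` is level of
exponent `5`. [cite: Kubota1965, §4 Lemma 2] [cite: Hazama2003CyclicCM, Prop. 4.3] [cite: Dodson1984, §3.1.1 Theorem] -/
theorem cmTypeRank_add_ncard_add_four_mul_ncard_eightyEight [IsCyclotomicExtension {88} ℚ L] (Φ : CMType L) :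
    cmTypeRank Φ + {F : IntermediateField ℚ L | Module.finrank ℚ F = 2 ∧ ¬ IsTotallyReal F ∧
        ∀ τ : F →+* ℂ, {φ : L →+* ℂ | φ.comp (algebraMap F L) = τ ∧ φ ∈ Φ.1}.ncard =
          {φ : L →+* ℂ | φ.comp (algebraMap F L) = τ ∧ φ ∉ Φ.1}.ncard}.ncard +
      4 * {F : IntermediateField ℚ L | Module.finrank ℚ F = 10 ∧ ¬ IsTotallyReal F ∧
        ∀ σ : F ≃ₐ[ℚ] F, σ ^ (5 : ℕ) = AlgEquiv.refl → ∀ τ : F →+* ℂ,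
          {φ : L →+* ℂ | φ.comp (algebraMap F L) = τ.comp σ.toRingEquiv.toRingHom ∧ φ ∈ Φ.1}.ncard =
            {φ : L →+* ℂ | φ.comp (algebraMap F L) = τ ∧ φ ∈ Φ.1}.ncard}.ncard = 21 := by
  haveI : Fact (Nat.Prime 5) := ⟨Nat.prime_five⟩
  have h := cmTypeRank_add_ncard_add_mul_ncard_eq_of_isCyclotomicExtension (L := L) (q := 88) (by norm_num)
    (by decide : (5 : ℕ) ≠ 2) units_pow_ten_eightyEight Φ
  have hφ : Nat.totient 88 = 40 := by decide
  rw [hφ] at h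
  exact h

/-- **`ℚ(ζ₈₈)`: THE HODGE CONJECTURE FOR ALL POWERS of every abelian variety with complex multiplication by `ℚ(ζ₈₈)` (CM `20`-folds) whose type
is of Weil type over no imaginary quadratic subfield and level of exponent `5` over no CM subfield of degree `10`** — UNCONDITIONAL.
[cite: Gordon1999HodgeAVSurvey, Thm. 6.4 and §9.3] [cite: Kubota1965, §4 Lemma 2] -/
theorem hodgeConjectureFor_pow_of_forall_eightyEight [IsCyclotomicExtension {88} ℚ L]
    (hW : ∀ F : IntermediateField ℚ L, Module.finrank ℚ F = 2 → ¬ IsTotallyReal F →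
        ¬ ∀ τ : F →+* ℂ, {φ : L →+* ℂ | φ.comp (algebraMap F L) = τ ∧ φ ∈ Φ.1}.ncard =
          {φ : L →+* ℂ | φ.comp (algebraMap F L) = τ ∧ φ ∉ Φ.1}.ncard)
    (hL : ∀ F : IntermediateField ℚ L, Module.finrank ℚ F = 2 * 5 → ¬ IsTotallyReal F →
        ¬ ∀ σ : F ≃ₐ[ℚ] F, σ ^ (5 : ℕ) = AlgEquiv.refl → ∀ τ : F →+* ℂ,
          {φ : L →+* ℂ | φ.comp (algebraMap F L) = τ.comp σ.toRingEquiv.toRingHom ∧ φ ∈ Φ.1}.ncard =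
            {φ : L →+* ℂ | φ.comp (algebraMap F L) = τ ∧ φ ∈ Φ.1}.ncard)
    (hA : IsCMTypeRealisation Φ A ι θ) (n : ℕ) :
    HodgeConjectureFor (⨁ fun _ : Fin n => A).dim (⨁ fun _ : Fin n => A).X :=
  haveI : Fact (Nat.Prime 5) := ⟨Nat.prime_five⟩
  hodgeConjectureFor_pow_of_forall_of_isCyclotomicExtension (q := 88) (by norm_num) (by decide) units_pow_ten_eightyEight
    hW hL hA n

/-- `u¹⁰ = 1` for every unit of `ℤ/132`: `(ℤ/132)ˣ ≅ (ℤ/2)² × ℤ/10` (kernel decision on the residues coprime to `132`).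
[cite: Washington1997, Ch. 2 Thm. 2.5] -/
theorem units_pow_ten_oneHundredThirtyTwo (u : (ZMod 132)ˣ) : u ^ (2 * 5) = 1 := by
  have h : ∀ a : ZMod 132, Nat.Coprime a.val 132 → a ^ 10 = 1 := by decide +kernel
  rw [show (2 * 5 : ℕ) = 10 by norm_num]
  exact Units.ext (by rw [Units.val_pow_eq_pow_val, h _ (ZMod.val_coe_unit_coprime u), Units.val_one])

/-- **`ℚ(ζ₁₃₂)` (degree `40`, `Gal ≅ (ℤ/2)² × ℤ/10`): the rank formula `Rank(Φ) + b(Φ) + 4·e(Φ) = 21`** for every CM type — `b` = the number of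
imaginary quadratic subfields over which `Φ` is of Weil type, `e` = the number of (cyclic) CM subfields of degree `10` over which `Φ` is level of
exponent `5`. [cite: Kubota1965, §4 Lemma 2] [cite: Hazama2003CyclicCM, Prop. 4.3] [cite: Dodson1984, §3.1.1 Theorem] -/
theorem cmTypeRank_add_ncard_add_four_mul_ncard_oneHundredThirtyTwo [IsCyclotomicExtension {132} ℚ L] (Φ : CMType L) :
    cmTypeRank Φ + {F : IntermediateField ℚ L | Module.finrank ℚ F = 2 ∧ ¬ IsTotallyReal F ∧
        ∀ τ : F →+* ℂ, {φ : L →+* ℂ | φ.comp (algebraMap F L) = τ ∧ φ ∈ Φ.1}.ncard =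
          {φ : L →+* ℂ | φ.comp (algebraMap F L) = τ ∧ φ ∉ Φ.1}.ncard}.ncard +
      4 * {F : IntermediateField ℚ L | Module.finrank ℚ F = 10 ∧ ¬ IsTotallyReal F ∧
        ∀ σ : F ≃ₐ[ℚ] F, σ ^ (5 : ℕ) = AlgEquiv.refl → ∀ τ : F →+* ℂ,
          {φ : L →+* ℂ | φ.comp (algebraMap F L) = τ.comp σ.toRingEquiv.toRingHom ∧ φ ∈ Φ.1}.ncard =
            {φ : L →+* ℂ | φ.comp (algebraMap F L) = τ ∧ φ ∈ Φ.1}.ncard}.ncard = 21 := by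
  haveI : Fact (Nat.Prime 5) := ⟨Nat.prime_five⟩
  have h := cmTypeRank_add_ncard_add_mul_ncard_eq_of_isCyclotomicExtension (L := L) (q := 132) (by norm_num)
    (by decide : (5 : ℕ) ≠ 2) units_pow_ten_oneHundredThirtyTwo Φ
  have hφ : Nat.totient 132 = 40 := by decide
  rw [hφ] at h
  exact h

/-- **`ℚ(ζ₁₃₂)`: THE HODGE CONJECTURE FOR ALL POWERS of every abelian variety with complex multiplication by `ℚ(ζ₁₃₂)` (CM `20`-folds) whose type
is of Weil type over no imaginary quadratic subfield and level of exponent `5` over no CM subfield of degree `10`** — UNCONDITIONAL.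
[cite: Gordon1999HodgeAVSurvey, Thm. 6.4 and §9.3] [cite: Kubota1965, §4 Lemma 2] -/
theorem hodgeConjectureFor_pow_of_forall_oneHundredThirtyTwo [IsCyclotomicExtension {132} ℚ L]
    (hW : ∀ F : IntermediateField ℚ L, Module.finrank ℚ F = 2 → ¬ IsTotallyReal F →
        ¬ ∀ τ : F →+* ℂ, {φ : L →+* ℂ | φ.comp (algebraMap F L) = τ ∧ φ ∈ Φ.1}.ncard =
          {φ : L →+* ℂ | φ.comp (algebraMap F L) = τ ∧ φ ∉ Φ.1}.ncard)
    (hL : ∀ F : IntermediateField ℚ L, Module.finrank ℚ F = 2 * 5 → ¬ IsTotallyReal F →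
        ¬ ∀ σ : F ≃ₐ[ℚ] F, σ ^ (5 : ℕ) = AlgEquiv.refl → ∀ τ : F →+* ℂ,
          {φ : L →+* ℂ | φ.comp (algebraMap F L) = τ.comp σ.toRingEquiv.toRingHom ∧ φ ∈ Φ.1}.ncard =
            {φ : L →+* ℂ | φ.comp (algebraMap F L) = τ ∧ φ ∈ Φ.1}.ncard)
    (hA : IsCMTypeRealisation Φ A ι θ) (n : ℕ) :
    HodgeConjectureFor (⨁ fun _ : Fin n => A).dim (⨁ fun _ : Fin n => A).X :=
  haveI : Fact (Nat.Prime 5) := ⟨Nat.prime_five⟩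
  hodgeConjectureFor_pow_of_forall_of_isCyclotomicExtension (q := 132) (by norm_num) (by decide) units_pow_ten_oneHundredThirtyTwo
    hW hL hA n

/-! ### The levels `69, 92, 138` (`(ℤ/q)ˣ ≅ ℤ/2 × ℤ/22`, `φ(q) = 44`): exponent `22 = 2·11` — appended in generation 64 («φ(N) = 44» instances) -/

/-- `u²² = 1` for every unit of `ℤ/69`: `(ℤ/69)ˣ ≅ ℤ/2 × ℤ/22` (kernel decision on the residues coprime to `69`).
[cite: Washington1997, Ch. 2 Thm. 2.5] -/
theorem units_pow_twentyTwo_sixtyNine (u : (ZMod 69)ˣ) : u ^ (2 * 11) = 1 := by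
  have h : ∀ a : ZMod 69, Nat.Coprime a.val 69 → a ^ 22 = 1 := by decide +kernel
  rw [show (2 * 11 : ℕ) = 22 by norm_num]
  exact Units.ext (by rw [Units.val_pow_eq_pow_val, h _ (ZMod.val_coe_unit_coprime u), Units.val_one])

/-- **`ℚ(ζ₆₉)` (degree `44`, `Gal ≅ ℤ/2 × ℤ/22`): the rank formula `Rank(Φ) + b(Φ) + 10·e(Φ) = 23`** for every CM type — `b` = the number of
imaginary quadratic subfields over which `Φ` is of Weil type, `e` = the number of (cyclic) CM subfields of degree `22` over which `Φ` is level of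
exponent `11` (the `NonCyclicFourTimesPrime` theorem of the lane refines this on PRIMITIVE types: `e = 0`, `b ≤ 1`). [cite: Kubota1965, §4 Lemma 2]
[cite: Hazama2003CyclicCM, Prop. 4.3] [cite: Dodson1984, §3.1.1 Theorem] -/
theorem cmTypeRank_add_ncard_add_ten_mul_ncard_sixtyNine [IsCyclotomicExtension {69} ℚ L] (Φ : CMType L) :
    cmTypeRank Φ + {F : IntermediateField ℚ L | Module.finrank ℚ F = 2 ∧ ¬ IsTotallyReal F ∧
        ∀ τ : F →+* ℂ, {φ : L →+* ℂ | φ.comp (algebraMap F L) = τ ∧ φ ∈ Φ.1}.ncard =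
          {φ : L →+* ℂ | φ.comp (algebraMap F L) = τ ∧ φ ∉ Φ.1}.ncard}.ncard +
      10 * {F : IntermediateField ℚ L | Module.finrank ℚ F = 22 ∧ ¬ IsTotallyReal F ∧
        ∀ σ : F ≃ₐ[ℚ] F, σ ^ (11 : ℕ) = AlgEquiv.refl → ∀ τ : F →+* ℂ,
          {φ : L →+* ℂ | φ.comp (algebraMap F L) = τ.comp σ.toRingEquiv.toRingHom ∧ φ ∈ Φ.1}.ncard =
            {φ : L →+* ℂ | φ.comp (algebraMap F L) = τ ∧ φ ∈ Φ.1}.ncard}.ncard = 23 := by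
  haveI : Fact (Nat.Prime 11) := ⟨by norm_num⟩
  have h := cmTypeRank_add_ncard_add_mul_ncard_eq_of_isCyclotomicExtension (L := L) (q := 69) (by norm_num)
    (by decide : (11 : ℕ) ≠ 2) units_pow_twentyTwo_sixtyNine Φ
  have hφ : Nat.totient 69 = 44 := by decide
  rw [hφ] at h
  exact h

/-- **`ℚ(ζ₆₉)`: THE HODGE CONJECTURE FOR ALL POWERS of every abelian variety with complex multiplication by `ℚ(ζ₆₉)` (CM `22`-folds) whose type
is of Weil type over no imaginary quadratic subfield and level of exponent `11` over no CM subfield of degree `22`** — UNCONDITIONAL.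
[cite: Gordon1999HodgeAVSurvey, Thm. 6.4 and §9.3] [cite: Kubota1965, §4 Lemma 2] -/
theorem hodgeConjectureFor_pow_of_forall_sixtyNine [IsCyclotomicExtension {69} ℚ L]
    (hW : ∀ F : IntermediateField ℚ L, Module.finrank ℚ F = 2 → ¬ IsTotallyReal F →
        ¬ ∀ τ : F →+* ℂ, {φ : L →+* ℂ | φ.comp (algebraMap F L) = τ ∧ φ ∈ Φ.1}.ncard =
          {φ : L →+* ℂ | φ.comp (algebraMap F L) = τ ∧ φ ∉ Φ.1}.ncard)
    (hL : ∀ F : IntermediateField ℚ L, Module.finrank ℚ F = 2 * 11 → ¬ IsTotallyReal F →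
        ¬ ∀ σ : F ≃ₐ[ℚ] F, σ ^ (11 : ℕ) = AlgEquiv.refl → ∀ τ : F →+* ℂ,
          {φ : L →+* ℂ | φ.comp (algebraMap F L) = τ.comp σ.toRingEquiv.toRingHom ∧ φ ∈ Φ.1}.ncard =
            {φ : L →+* ℂ | φ.comp (algebraMap F L) = τ ∧ φ ∈ Φ.1}.ncard)
    (hA : IsCMTypeRealisation Φ A ι θ) (n : ℕ) :
    HodgeConjectureFor (⨁ fun _ : Fin n => A).dim (⨁ fun _ : Fin n => A).X :=
  haveI : Fact (Nat.Prime 11) := ⟨by norm_num⟩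
  hodgeConjectureFor_pow_of_forall_of_isCyclotomicExtension (q := 69) (by norm_num) (by decide) units_pow_twentyTwo_sixtyNine
    hW hL hA n

/-- `u²² = 1` for every unit of `ℤ/92`: `(ℤ/92)ˣ ≅ ℤ/2 × ℤ/22` (kernel decision on the residues coprime to `92`).
[cite: Washington1997, Ch. 2 Thm. 2.5] -/
theorem units_pow_twentyTwo_ninetyTwo (u : (ZMod 92)ˣ) : u ^ (2 * 11) = 1 := by
  have h : ∀ a : ZMod 92, Nat.Coprime a.val 92 → a ^ 22 = 1 := by decide +kernel
  rw [show (2 * 11 : ℕ) = 22 by norm_num]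
  exact Units.ext (by rw [Units.val_pow_eq_pow_val, h _ (ZMod.val_coe_unit_coprime u), Units.val_one])

/-- **`ℚ(ζ₉₂)` (degree `44`, `Gal ≅ ℤ/2 × ℤ/22`): the rank formula `Rank(Φ) + b(Φ) + 10·e(Φ) = 23`** for every CM type — `b` = the number of
imaginary quadratic subfields over which `Φ` is of Weil type, `e` = the number of (cyclic) CM subfields of degree `22` over which `Φ` is level of
exponent `11` (the `NonCyclicFourTimesPrime` theorem of the lane refines this on PRIMITIVE types: `e = 0`, `b ≤ 1`). [cite: Kubota1965, §4 Lemma 2]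
[cite: Hazama2003CyclicCM, Prop. 4.3] [cite: Dodson1984, §3.1.1 Theorem] -/
theorem cmTypeRank_add_ncard_add_ten_mul_ncard_ninetyTwo [IsCyclotomicExtension {92} ℚ L] (Φ : CMType L) :
    cmTypeRank Φ + {F : IntermediateField ℚ L | Module.finrank ℚ F = 2 ∧ ¬ IsTotallyReal F ∧
        ∀ τ : F →+* ℂ, {φ : L →+* ℂ | φ.comp (algebraMap F L) = τ ∧ φ ∈ Φ.1}.ncard =
          {φ : L →+* ℂ | φ.comp (algebraMap F L) = τ ∧ φ ∉ Φ.1}.ncard}.ncard +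
      10 * {F : IntermediateField ℚ L | Module.finrank ℚ F = 22 ∧ ¬ IsTotallyReal F ∧
        ∀ σ : F ≃ₐ[ℚ] F, σ ^ (11 : ℕ) = AlgEquiv.refl → ∀ τ : F →+* ℂ,
          {φ : L →+* ℂ | φ.comp (algebraMap F L) = τ.comp σ.toRingEquiv.toRingHom ∧ φ ∈ Φ.1}.ncard =
            {φ : L →+* ℂ | φ.comp (algebraMap F L) = τ ∧ φ ∈ Φ.1}.ncard}.ncard = 23 := by
  haveI : Fact (Nat.Prime 11) := ⟨by norm_num⟩
  have h := cmTypeRank_add_ncard_add_mul_ncard_eq_of_isCyclotomicExtension (L := L) (q := 92) (by norm_num)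
    (by decide : (11 : ℕ) ≠ 2) units_pow_twentyTwo_ninetyTwo Φ
  have hφ : Nat.totient 92 = 44 := by decide
  rw [hφ] at h
  exact h

/-- **`ℚ(ζ₉₂)`: THE HODGE CONJECTURE FOR ALL POWERS of every abelian variety with complex multiplication by `ℚ(ζ₉₂)` (CM `22`-folds) whose type
is of Weil type over no imaginary quadratic subfield and level of exponent `11` over no CM subfield of degree `22`** — UNCONDITIONAL.
[cite: Gordon1999HodgeAVSurvey, Thm. 6.4 and §9.3] [cite: Kubota1965, §4 Lemma 2] -/
theorem hodgeConjectureFor_pow_of_forall_ninetyTwo [IsCyclotomicExtension {92} ℚ L]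
    (hW : ∀ F : IntermediateField ℚ L, Module.finrank ℚ F = 2 → ¬ IsTotallyReal F →
        ¬ ∀ τ : F →+* ℂ, {φ : L →+* ℂ | φ.comp (algebraMap F L) = τ ∧ φ ∈ Φ.1}.ncard =
          {φ : L →+* ℂ | φ.comp (algebraMap F L) = τ ∧ φ ∉ Φ.1}.ncard)
    (hL : ∀ F : IntermediateField ℚ L, Module.finrank ℚ F = 2 * 11 → ¬ IsTotallyReal F →
        ¬ ∀ σ : F ≃ₐ[ℚ] F, σ ^ (11 : ℕ) = AlgEquiv.refl → ∀ τ : F →+* ℂ,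
          {φ : L →+* ℂ | φ.comp (algebraMap F L) = τ.comp σ.toRingEquiv.toRingHom ∧ φ ∈ Φ.1}.ncard =
            {φ : L →+* ℂ | φ.comp (algebraMap F L) = τ ∧ φ ∈ Φ.1}.ncard)
    (hA : IsCMTypeRealisation Φ A ι θ) (n : ℕ) :
    HodgeConjectureFor (⨁ fun _ : Fin n => A).dim (⨁ fun _ : Fin n => A).X :=
  haveI : Fact (Nat.Prime 11) := ⟨by norm_num⟩
  hodgeConjectureFor_pow_of_forall_of_isCyclotomicExtension (q := 92) (by norm_num) (by decide) units_pow_twentyTwo_ninetyTwo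
    hW hL hA n

/-- `u²² = 1` for every unit of `ℤ/138`: `(ℤ/138)ˣ ≅ ℤ/2 × ℤ/22` (kernel decision on the residues coprime to `138`).
[cite: Washington1997, Ch. 2 Thm. 2.5] -/
theorem units_pow_twentyTwo_oneHundredThirtyEight (u : (ZMod 138)ˣ) : u ^ (2 * 11) = 1 := by
  have h : ∀ a : ZMod 138, Nat.Coprime a.val 138 → a ^ 22 = 1 := by decide +kernel
  rw [show (2 * 11 : ℕ) = 22 by norm_num]
  exact Units.ext (by rw [Units.val_pow_eq_pow_val, h _ (ZMod.val_coe_unit_coprime u), Units.val_one])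

/-- **`ℚ(ζ₁₃₈) = ℚ(ζ₆₉)` (degree `44`, `Gal ≅ ℤ/2 × ℤ/22`): the rank formula `Rank(Φ) + b(Φ) + 10·e(Φ) = 23`** for every CM type — `b` = the number of
imaginary quadratic subfields over which `Φ` is of Weil type, `e` = the number of (cyclic) CM subfields of degree `22` over which `Φ` is level of
exponent `11` (the `NonCyclicFourTimesPrime` theorem of the lane refines this on PRIMITIVE types: `e = 0`, `b ≤ 1`). [cite: Kubota1965, §4 Lemma 2]
[cite: Hazama2003CyclicCM, Prop. 4.3] [cite: Dodson1984, §3.1.1 Theorem] -/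
theorem cmTypeRank_add_ncard_add_ten_mul_ncard_oneHundredThirtyEight [IsCyclotomicExtension {138} ℚ L] (Φ : CMType L) :
    cmTypeRank Φ + {F : IntermediateField ℚ L | Module.finrank ℚ F = 2 ∧ ¬ IsTotallyReal F ∧
        ∀ τ : F →+* ℂ, {φ : L →+* ℂ | φ.comp (algebraMap F L) = τ ∧ φ ∈ Φ.1}.ncard =
          {φ : L →+* ℂ | φ.comp (algebraMap F L) = τ ∧ φ ∉ Φ.1}.ncard}.ncard +
      10 * {F : IntermediateField ℚ L | Module.finrank ℚ F = 22 ∧ ¬ IsTotallyReal F ∧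
        ∀ σ : F ≃ₐ[ℚ] F, σ ^ (11 : ℕ) = AlgEquiv.refl → ∀ τ : F →+* ℂ,
          {φ : L →+* ℂ | φ.comp (algebraMap F L) = τ.comp σ.toRingEquiv.toRingHom ∧ φ ∈ Φ.1}.ncard =
            {φ : L →+* ℂ | φ.comp (algebraMap F L) = τ ∧ φ ∈ Φ.1}.ncard}.ncard = 23 := by
  haveI : Fact (Nat.Prime 11) := ⟨by norm_num⟩
  have h := cmTypeRank_add_ncard_add_mul_ncard_eq_of_isCyclotomicExtension (L := L) (q := 138) (by norm_num)
    (by decide : (11 : ℕ) ≠ 2) units_pow_twentyTwo_oneHundredThirtyEight Φ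
  have hφ : Nat.totient 138 = 44 := by decide
  rw [hφ] at h
  exact h

/-- **`ℚ(ζ₁₃₈) = ℚ(ζ₆₉)`: THE HODGE CONJECTURE FOR ALL POWERS of every abelian variety with complex multiplication by `ℚ(ζ₁₃₈) = ℚ(ζ₆₉)` (CM `22`-folds) whose type
is of Weil type over no imaginary quadratic subfield and level of exponent `11` over no CM subfield of degree `22`** — UNCONDITIONAL.
[cite: Gordon1999HodgeAVSurvey, Thm. 6.4 and §9.3] [cite: Kubota1965, §4 Lemma 2] -/
theorem hodgeConjectureFor_pow_of_forall_oneHundredThirtyEight [IsCyclotomicExtension {138} ℚ L]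
    (hW : ∀ F : IntermediateField ℚ L, Module.finrank ℚ F = 2 → ¬ IsTotallyReal F →
        ¬ ∀ τ : F →+* ℂ, {φ : L →+* ℂ | φ.comp (algebraMap F L) = τ ∧ φ ∈ Φ.1}.ncard =
          {φ : L →+* ℂ | φ.comp (algebraMap F L) = τ ∧ φ ∉ Φ.1}.ncard)
    (hL : ∀ F : IntermediateField ℚ L, Module.finrank ℚ F = 2 * 11 → ¬ IsTotallyReal F →
        ¬ ∀ σ : F ≃ₐ[ℚ] F, σ ^ (11 : ℕ) = AlgEquiv.refl → ∀ τ : F →+* ℂ,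
          {φ : L →+* ℂ | φ.comp (algebraMap F L) = τ.comp σ.toRingEquiv.toRingHom ∧ φ ∈ Φ.1}.ncard =
            {φ : L →+* ℂ | φ.comp (algebraMap F L) = τ ∧ φ ∈ Φ.1}.ncard)
    (hA : IsCMTypeRealisation Φ A ι θ) (n : ℕ) :
    HodgeConjectureFor (⨁ fun _ : Fin n => A).dim (⨁ fun _ : Fin n => A).X :=
  haveI : Fact (Nat.Prime 11) := ⟨by norm_num⟩
  hodgeConjectureFor_pow_of_forall_of_isCyclotomicExtension (q := 138) (by norm_num) (by decide) units_pow_twentyTwo_oneHundredThirtyEight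
    hW hL hA n

end Cyclotomic

end ExponentTwicePrime

end Literature.AlgebraicGeometry.Pohlmann1968

end
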